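import Literature.Geometry.Lorentzian.SpacetimeKretschmannScalar
import Literature.Geometry.Lorentzian.BackgroundChartCalculus
import Literature.Geometry.Lorentzian.KerrTimelikeSpan
import HarnessLib

/-!
# Curvature tracking along `C²`-quiet windowed Kerr collars of ANY spacetime: mass tracking,
# strong-field localisation, and a non-vacuous spin bound from the sign of the Kretschmann scalar

Topic `Geometry/Lorentzian`; everything PROVED (the closed form of the Kretschmann scalar of Kerr,
`Kerr.kretschmannScalar_closedForm` of `KerrKretschmannScalar.lean`, is an unproved NAMED FACT and
enters as the hypothesis `(hQ : Kerr.kretschmannScalar_closedForm)` of the theorems that EVALUATE the Kerr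
scalar — mass tracking, localisation, spin bound — which are therefore CONDITIONAL on it; the tracking
theorem itself, `abs_kretschmannAt_sub_rmNormSqAt_le`, is unconditional). Continues
`FlatQuietCollarExclusion.lean` (same service: crux `GenericCensorshipCollarMargin`,
stmt-FinalStateConjecture-10809 of summit `FinalStateConjecture`, line `hair-vacates-the-margin`, stub
`MarginWall3`), replacing MINKOWSKI SPACE there by an ARBITRARY spacetime and flatness of the chart metric by
the Kretschmann scalar `Spacetime.kretschmannAt` (`SpacetimeKretschmannScalar.lean`) of the host at ONE image
point.

## Main statements (`KerrWindow`, and `Spacetime` for Part G0)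

* `Spacetime.deviation_comp_of_isIsometricImmersion`, `Spacetime.truncDeviationCk_comp_of_isIsometricImmersion`
  (Part G0) — the chart deviation and its `Cᵏ` slab norm are INVARIANT under isometric immersions of the host
  (`E^* g_𝓢 = g_𝓤` ⇒ `(E ∘ Ψ)^* g_𝓢 = Ψ^* g_𝓤`): the quietness hypotheses of near-Kerr collar clauses do not
  depend on the isometric copy of a development in which a chart is read.
* `IsSlabPointMap`, `ptOf`, `jetOf0/1/2`, `exists_jetOf_bound` — the uniform `C²` bounds of
  `FlatQuietCollarExclusion.lean` (there at the equatorial point) at the boosted image of ANY rest-frame slab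
  point map `q(M, a)` with `M < r ≤ 3M`, `t* = 0` (instances: `eqPoint` and the AXIAL point `axPoint`, both at `r = 2M`).
* `abs_kretschmannAt_sub_rmNormSqAt_le` — **CURVATURE TRACKING** (unconditional): for every label window
  `m₀ > 0` and boost bound `ρ₀` there are `δ₁ > 0`, `A ≥ 0` such that a thick Kerr collar chart `Φ₁` of ANY
  spacetime `𝓢` modelled on the boosted Kerr star background `(Λ, c, M₁, a₁)`, `m₀ ≤ M₁ ≤ m₀⁻¹`,
  `|a₁| ≤ M₁`, `‖Λ‖, ‖Λ⁻¹‖ ≤ ρ₀`, smooth on the collar layer and `δ`-quiet in `C²` on the thick slab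
  `{t* = 0, r ≤ 3M₁}` (DHRT arXiv:2104.08222 §1: `truncDeviationCk B Φ₁ 2 (3M₁) 0 ≤ δ`), `δ ≤ δ₁`, has
  `| kretschmannAt 𝓢 (Φ₁ (Λ q + c)) − |Rm|²_{g_{M₁,a₁}}(q) | ≤ A δ`.
* `abs_kretschmannAt_sub_le_of_truncDeviationCk_le` — **MASS TRACKING** (equatorial point, `hQ`): the host
  value is within `Aδ` of `48M₁²/(2M₁)⁶ = ¾M₁⁻⁴`; the mass label is read off the host's curvature.
* `truncDeviationCk_gt_of_kretschmannAt_le` (+ `_on_slab`) — **LOCALISATION**: `|kretschmannAt| ≤ (3/8)m₀⁴`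
  at the equatorial image point forces `C²`-deviation `> δ₀(m₀, ρ₀)`: windowed quiet collars of bounded
  boost live in the strong-field region; far field, radiation zone and flat space present none.
* `abs_spin_lt_of_kretschmannAt_axial_ge` (+ `abs_spin_le_of_kretschmannAt_nonneg_on_slab`) — **SPIN
  BOUND** (axial point, `hQ`), for every ratio `χ` beyond the sign change of the axial sextic
  `f(s) = 1 − 15s + 15s² − s³` (`axialSextic`; `f((χ/2)²) < 0` iff `χ > 2 tan 15° ≈ 0.536`, e.g. `χ = 3/5`,
  `axialSextic_three_fifths_neg`): a `δ₀`-quiet windowed collar whose axial image point has Kretschmann scalar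
  `≥ (1536/15625) f((χ/2)²) m₀⁴` (a negative threshold; e.g. `≥ 0`) has `|a₁| < χ M₁`, because `|Rm|²` of Kerr at
  `(0,0,0,2M)` is `48M² Re[(2M + ia)⁶]/((2M)² + a²)⁶ = 48M²(2M)⁶ f(a²/(2M)²)/((2M)² + a²)⁶ ≤ (3072/15625) f((χ/2)²) M⁻⁴`
  once `|a| ≥ χM` (`kretschmann_axPoint_le`; `f` is decreasing on `[0, 1/4]`). This is the first NON-VACUOUS
  instance of the collar-margin mechanism of the crux: hosts with `|Rm|² ≥ 0` on the slab image satisfy the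
  windowed, bounded-boost clause with every such `χ₁ = χ < 1` at order `k₁ = 2`.
* `Kerr.kretschmannAt_spacetime_nonneg_of_le_radius` (`|Rm|² ≥ 0` wherever `r ≥ 4|a|`) and the **census in a Kerr
  host** `Kerr.radius_axialImage_lt_of_quietCollar`: a `δ₀`-quiet windowed bounded-boost collar of label ratio `≥ χ`
  maps its axial slab point within Kerr–Schild radius `4|a| ≤ 4M` of the centre (rapidly-labelled quiet collars hug
  the hole); `Kerr.kretschmannAt_spacetime_nonneg`, `Kerr.abs_spin_le_of_quietCollar_spacetime_slow`,
  `Kerr.windowedCollarMargin_spacetime_slow` (clause form: `χ₁ = 3/5`, `k₁ = 2`, `K₁ = ∅`) (Part I, `hQ`,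
  `[Kerr.Facts]`) — SLOWLY ROTATING KERR SPACETIMES (`|a| ≤ M/4`, chart domain `r > r₀ ≥ M`) have
  `|Rm|² ≥ 0` everywhere, hence satisfy the clause non-vacuously with `χ₁ = 3/5`: every `δ₀`-quiet windowed
  bounded-boost thick collar chart into them has `|a₁| ≤ (3/5)M₁` (and for `r₀ = M` the identity chart is one,
  of ratio `≤ 1/4` and deviation `0`) — the first black-hole certificate for the restated crux C‴;
  `Kerr.abs_kretschmannAt_spacetime_le` (`|Rm|² ≤ 192M²/r⁶` on every Kerr chart) and the MASS LOWER BOUND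
  `Kerr.inv_mass_pow_four_le_of_quietCollar` (`¾M₁⁻⁴ ≤ 192M⁻⁴ + Aδ` for quiet collars in a Kerr host with
  `r₀ ≥ M`: no small quiet collars in a big hole's chart).

## The argument (O'Neill 1983, Ch. 3; Kotschwar 2014 (8))

At `x_q = Λ q + c` the `2`-jets of the components `F = Φ₁^* g` (read through the parametrisation
`Φ₁ ∘ (chartAt E4 x)⁻¹` of `BackgroundChartCalculus.lean`; `jets_deviationExtend_general`) and of `g_B`
are `δ`-close, and both are bounded by one constant `N(m₀, ρ₀)` (`exists_jetOf_bound`,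
`exists_uniform_inverse_bound` over the compact window); hence `‖R_F − R_B‖ ≤ 42N⁵δ`
(`IsMetricOn.norm_riemAt_sub_le`), `‖R_F‖, ‖R_B‖ ≤ 11N⁴` (`norm_riemAt_apply_le_of_jets`),
`‖♯_F − ♯_B‖ ≤ N²δ`, so `| |Rm|²_F − |Rm|²_B | ≤ A(N) δ` (`abs_rmNormSqAt_sub_le`). Then
`|Rm|²_F(x_q) = kretschmannAt 𝓢 (Φ₁ x_q)` (chart independence, `rmNormSqAt_metricInCoords_eq_kretschmannAt`,
the components being nondegenerate at `x_q` for `δ ≤ δ₁`), and `|Rm|²_B(x_q) = |Rm|²_{g}(q)` by naturality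
under the Poincaré map. The closed form `hQ` (Visser arXiv:0706.0622 §3) evaluates `|Rm|²_g` at the
equatorial point (`¾M⁻⁴`) and at the axial point (`48M² Re[(2M + ia)⁶]/((2M)² + a²)⁶`).

## References

* M. Dafermos, G. Holzegel, I. Rodnianski, M. Taylor, arXiv:2104.08222, §1 (near-Kerr charts). [arXiv210408222]
* B. O'Neill, *Semi-Riemannian geometry* (1983), Ch. 3, Lemma 3.38, Prop. 3.59. [ONeill1983]
* B. Kotschwar, Comm. Anal. Geom. 22 (2014), §1.1 (8) (curvature difference identities). [Kotschwar2014]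
* M. Visser, *The Kerr spacetime: a brief introduction*, arXiv:0706.0622, §3, (35). [arXiv07060622]
* R. P. Kerr, A. Schild (1965), §3. [KerrSchild1965]
-/

noncomputable section

-- instance search through nested operator types (as in `CoordCurvature`)
set_option maxSynthPendingDepth 3

open Set Function Filter ContinuousLinearMap Metric
open scoped Topology Manifold ContDiff

namespace Literature.Geometry.Lorentzian

/-- Shortcut: the space of bilinear forms on `E4` is a normed group (canonical instance). [folklore] -/
local instance instNormedAddCommGroupBilinE4W : NormedAddCommGroup (E4 →L[ℝ] E4 →L[ℝ] ℝ) :=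
  ContinuousLinearMap.toNormedAddCommGroup

/-- Shortcut: the space of bilinear forms on `E4` is a normed space (canonical instance). [folklore] -/
local instance instNormedSpaceBilinE4W : NormedSpace ℝ (E4 →L[ℝ] E4 →L[ℝ] ℝ) :=
  ContinuousLinearMap.toNormedSpace

/-! ## Part G0: the chart deviation is invariant under isometric immersions of the host -/

namespace Spacetime

/-- **Pointwise invariance of the deviation under an isometric immersion of the host**: for
`E : 𝓤 → 𝓢` with `E^* g_𝓢 = g_𝓤` and a chart map `Ψ : B.domain → 𝓤` differentiable at `x`,
`((E ∘ Ψ)^* g_𝓢 − g_B)(x) = (Ψ^* g_𝓤 − g_B)(x)` (chain rule `d(E ∘ Ψ) = dE ∘ dΨ`). O'Neill 1983, Ch. 3,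
p. 58 (functoriality of the pullback). [cite: ONeill1983, Ch. 3, p. 58] -/
theorem deviation_comp_of_isIsometricImmersion {𝓤 : Spacetime 4} (𝓢 : Spacetime 4)
    {E : 𝓤.carrier → 𝓢.carrier}
    (hE : 𝓤.metric.IsIsometricImmersion 𝓢.metric.toPseudoRiemannianMetric E) (B : ModelBackground)
    {Ψ : B.domain → 𝓤.carrier} {x : B.domain} (hΨ : MDifferentiableAt 𝓘(ℝ, E4) (𝓡 4) Ψ x) :
    𝓢.deviation B (E ∘ Ψ) x = 𝓤.deviation B Ψ x := by
  have hEd : MDifferentiableAt (𝓡 4) (𝓡 4) E (Ψ x) := (hE.1 (Ψ x)).mdifferentiableAt (by simp)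
  have hchain : mfderiv 𝓘(ℝ, E4) (𝓡 4) (E ∘ Ψ) x =
      (mfderiv (𝓡 4) (𝓡 4) E (Ψ x)).comp (mfderiv 𝓘(ℝ, E4) (𝓡 4) Ψ x) := mfderiv_comp x hEd hΨ
  ext v w
  rw [deviation_apply, deviation_apply, hchain]
  have key := DFunLike.congr_fun (DFunLike.congr_fun (hE.2 (Ψ x))
    (mfderiv 𝓘(ℝ, E4) (𝓡 4) Ψ x v)) (mfderiv 𝓘(ℝ, E4) (𝓡 4) Ψ x w)
  exact congrArg (fun t : ℝ ↦ t - B.bilin x.1 v w) key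

/-- **The `Cᵏ` deviation on a truncated slab is invariant under isometric immersions of the host**, for
a chart map smooth on an open set of the domain containing the truncated slab: `truncDeviationCk` of
`E ∘ Ψ` equals that of `Ψ` (germ invariance of the sup norm, `supCkENorm_congr`). In particular the
quietness hypotheses of near-Kerr collar clauses do not depend on which isometric copy of a development the
chart is read in. [cite: arXiv210408222, §1] -/
theorem truncDeviationCk_comp_of_isIsometricImmersion {𝓤 : Spacetime 4} (𝓢 : Spacetime 4)
    {E : 𝓤.carrier → 𝓢.carrier}
    (hE : 𝓤.metric.IsIsometricImmersion 𝓢.metric.toPseudoRiemannianMetric E) (B : ModelBackground)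
    {Ψ : B.domain → 𝓤.carrier} {L : Set B.domain} (hL : IsOpen L)
    (hΨ : ContMDiffOn 𝓘(ℝ, E4) (𝓡 4) ∞ Ψ L) (k : ℕ) {R τ : ℝ} (hRL : B.truncTimeSlab R τ ⊆ L) :
    𝓢.truncDeviationCk B (E ∘ Ψ) k R τ = 𝓤.truncDeviationCk B Ψ k R τ := by
  refine supCkENorm_congr fun y hy ↦ ?_
  obtain ⟨x, hx, rfl⟩ := hy
  have hO : IsOpen (Subtype.val '' L : Set E4) := B.domain.isOpen.isOpenMap_subtype_val L hL
  filter_upwards [hO.mem_nhds (Set.mem_image_of_mem Subtype.val (hRL hx))] with z hz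
  obtain ⟨x', hx', rfl⟩ := hz
  have hd : MDifferentiableAt 𝓘(ℝ, E4) (𝓡 4) Ψ x' :=
    ((hΨ x' hx').contMDiffAt (hL.mem_nhds hx')).mdifferentiableAt (by simp)
  rw [deviationExtend_coe, deviationExtend_coe, deviation_comp_of_isIsometricImmersion 𝓢 hE B hd]

end Spacetime


/-! ## Part G: charts into an ARBITRARY spacetime — windowed quiet collars see `|Rm|² ≈ ¾M₁⁻⁴` -/

namespace KerrWindow

section GeneralChart

open MetricCoord

variable {𝓢 : Spacetime 4} {B : ModelBackground} {Φ : B.domain → 𝓢.carrier}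

/-- A chart map smooth on an open set `L` of the domain gives a parametrisation
`Φ ∘ (chartAt E4 x₀).symm : E4 → 𝓢` smooth on `L ⊆ E4` (the inverse chart is the inclusion).
[folklore] -/
theorem contMDiffOn_comp_chartAt_symm_image {L : Set B.domain}
    (hΦ : ContMDiffOn 𝓘(ℝ, E4) (𝓡 4) ∞ Φ L) (x₀ : B.domain) :
    ContMDiffOn 𝓘(ℝ, E4) (𝓡 4) ∞ (Φ ∘ (chartAt E4 x₀).symm) (Subtype.val '' L) := by
  refine hΦ.comp ((contMDiffOn_chart_symm (x := x₀)).mono ?_) ?_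
  · rw [OpensChart.chartAt_target]
    rintro _ ⟨z, _, rfl⟩
    exact z.2
  · rintro _ ⟨z, hz, rfl⟩
    show (chartAt E4 x₀).symm (z : E4) ∈ L
    have h : (chartAt E4 x₀).symm (z : E4) = z := Subtype.ext (OpensChart.chartAt_symm_val x₀ z.2)
    rw [h]
    exact hz

/-- The parametrisation agrees with the chart map on the domain. [folklore] -/
theorem comp_chartAt_symm_apply_coe (x₀ z : B.domain) :
    (Φ ∘ (chartAt E4 x₀).symm) (z : E4) = Φ z := by
  show Φ ((chartAt E4 x₀).symm (z : E4)) = Φ z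
  rw [show (chartAt E4 x₀).symm (z : E4) = z from Subtype.ext (OpensChart.chartAt_symm_val x₀ z.2)]

/-- **On the image of an open set of smooth points the extended deviation IS `Φ^* g − g_B`**, with
`Φ^* g` read as the components of the parametrisation `Φ ∘ (chartAt E4 x₀).symm`. [folklore] -/
theorem deviationExtend_eq_metricInCoords_sub {L : Set B.domain}
    (hΦ : ContMDiffOn 𝓘(ℝ, E4) (𝓡 4) ∞ Φ L) (hL : IsOpen L) (x₀ : B.domain) {y : E4}
    (hy : y ∈ (Subtype.val '' L : Set E4)) :
    𝓢.deviationExtend B Φ y = 𝓢.metricInCoords (Φ ∘ (chartAt E4 x₀).symm) y - B.bilin y := by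
  obtain ⟨z, hz, rfl⟩ := hy
  have hd : MDifferentiableAt 𝓘(ℝ, E4) (𝓡 4) Φ ⟨(z : E4), z.2⟩ :=
    ((hΦ z hz).contMDiffAt (hL.mem_nhds hz)).mdifferentiableAt (by simp)
  rw [𝓢.metricInCoords_comp_chartAt_symm_sub_eq_deviation B Φ x₀ z.2 hd,
    𝓢.deviationExtend_coe B Φ z]

/-- **The jets of the deviation at a smooth point are the differences of the jets** of the components
`Φ^* g` and of the (smooth) background components. [folklore] -/
theorem jets_deviationExtend_general {L : Set B.domain}
    (hΦ : ContMDiffOn 𝓘(ℝ, E4) (𝓡 4) ∞ Φ L) (hL : IsOpen L) (x₀ : B.domain)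
    (hB : ∀ y ∈ (Subtype.val '' L : Set E4), ContDiffAt ℝ ∞ B.bilin y)
    {y : E4} (hy : y ∈ (Subtype.val '' L : Set E4)) :
    𝓢.deviationExtend B Φ y = 𝓢.metricInCoords (Φ ∘ (chartAt E4 x₀).symm) y - B.bilin y ∧
    fderiv ℝ (𝓢.deviationExtend B Φ) y =
      fderiv ℝ (𝓢.metricInCoords (Φ ∘ (chartAt E4 x₀).symm)) y - fderiv ℝ B.bilin y ∧
    fderiv ℝ (fderiv ℝ (𝓢.deviationExtend B Φ)) y =
      fderiv ℝ (fderiv ℝ (𝓢.metricInCoords (Φ ∘ (chartAt E4 x₀).symm))) y -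
        fderiv ℝ (fderiv ℝ B.bilin) y := by
  have hO := isOpen_image_val hL
  set F := 𝓢.metricInCoords (Φ ∘ (chartAt E4 x₀).symm) with hF
  have hev : 𝓢.deviationExtend B Φ =ᶠ[𝓝 y] fun z ↦ F z - B.bilin z := by
    filter_upwards [hO.mem_nhds hy] with z hz
    exact deviationExtend_eq_metricInCoords_sub hΦ hL x₀ hz
  have hsm : ∀ z ∈ (Subtype.val '' L : Set E4), ContDiffAt ℝ ∞ F z := fun z hz ↦
    (𝓢.contDiffOn_metricInCoords hO (contMDiffOn_comp_chartAt_symm_image hΦ x₀)).contDiffAt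
      (hO.mem_nhds hz)
  refine ⟨deviationExtend_eq_metricInCoords_sub hΦ hL x₀ hy, ?_, ?_⟩
  · rw [hev.fderiv_eq]
    exact fderiv_sub ((hsm y hy).differentiableAt (by simp)) ((hB y hy).differentiableAt (by simp))
  · have h2 : fderiv ℝ (𝓢.deviationExtend B Φ) =ᶠ[𝓝 y] fderiv ℝ (fun z ↦ F z - B.bilin z) :=
      hev.fderiv
    rw [h2.fderiv_eq]
    exact KerrSchildChart.fderiv_fderiv_sub_of_isOpen hO hsm hB hy

end GeneralChart

section PointOf

open MetricCoord

/-- **Slab point maps.** A rest-frame comparison point `q(M, a)` on the THICK SLAB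
`{t* = 0, M < r ≤ 3M}` of the Kerr star chart, depending smoothly on the label for `M > 0` (the equatorial
point `eqPoint` and the axial point `axPoint`, both at `r = 2M`; any other slab point map will do).
[folklore] -/
structure IsSlabPointMap (q : ℝ × ℝ → E4) : Prop where
  contDiffAt : ∀ (n : WithTop ℕ∞) (M a : ℝ), 0 < M → ContDiffAt ℝ n q (M, a)
  radius_gt : ∀ M a : ℝ, 0 < M → M < Kerr.radius a (q (M, a))
  radius_le : ∀ M a : ℝ, 0 < M → Kerr.radius a (q (M, a)) ≤ 3 * M
  time_eq : ∀ M a : ℝ, q (M, a) 0 = 0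

variable (q : ℝ × ℝ → E4)

/-- The comparison point `x_p = T q(M, a)` of a parameter `p = (M, a, S, T)`. [folklore] -/
def ptOf (p : Param) : E4 := p.2.2.2 (q (p.1, p.2.1))

/-- The `0`-jet `G_p(x_p)`. [folklore] -/
def jetOf0 (p : Param) : E4 →L[ℝ] E4 →L[ℝ] ℝ := fam p (ptOf q p)

/-- The `1`-jet `DG_p(x_p)`. [folklore] -/
def jetOf1 (p : Param) : E4 →L[ℝ] E4 →L[ℝ] E4 →L[ℝ] ℝ := fderiv ℝ (fam p) (ptOf q p)

/-- The `2`-jet `D²G_p(x_p)`. [folklore] -/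
def jetOf2 (p : Param) : E4 →L[ℝ] E4 →L[ℝ] E4 →L[ℝ] E4 →L[ℝ] ℝ := fderiv ℝ (fderiv ℝ (fam p)) (ptOf q p)

variable {q}

/-- `S x_p = q(M, a)`. [folklore] -/
theorem apply_ptOf_of_mem {m₀ ρ₀ : ℝ} {p : Param} (hp : p ∈ paramSet m₀ ρ₀) :
    p.2.2.1 (ptOf q p) = q (p.1, p.2.1) := by
  obtain ⟨-, -, -, -, -, hST, -⟩ := hp
  show (p.2.2.1.comp p.2.2.2) (q (p.1, p.2.1)) = _
  rw [hST]
  rfl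

/-- `r(S x_p) > M > 0`. [folklore] -/
theorem radius_ptOf_pos_of_mem (hq : IsSlabPointMap q) {m₀ ρ₀ : ℝ} (hm₀ : 0 < m₀) {p : Param}
    (hp : p ∈ paramSet m₀ ρ₀) : 0 < Kerr.radius p.2.1 (p.2.2.1 (ptOf q p)) := by
  rw [apply_ptOf_of_mem hp]
  exact (mass_pos_of_mem hm₀ hp).trans (hq.radius_gt _ _ (mass_pos_of_mem hm₀ hp))

/-- `q(M, a)` lies in the star chart domain `{r > M}`. [folklore] -/
theorem mem_region_of_isSlabPointMap (hq : IsSlabPointMap q) {m₀ ρ₀ : ℝ} (hm₀ : 0 < m₀) {p : Param}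
    (hp : p ∈ paramSet m₀ ρ₀) : q (p.1, p.2.1) ∈ (Kerr.region p.2.1 p.1 : Set E4) := by
  have hM := mass_pos_of_mem hm₀ hp
  show max p.1 0 < Kerr.radius p.2.1 (q (p.1, p.2.1))
  rw [max_eq_left hM.le]
  exact hq.radius_gt _ _ hM

/-- `p ↦ x_p` is smooth at windowed parameters. [folklore] -/
theorem contDiffAt_ptOf (hq : IsSlabPointMap q) {n : WithTop ℕ∞} {m₀ ρ₀ : ℝ} (hm₀ : 0 < m₀) {p : Param}
    (hp : p ∈ paramSet m₀ ρ₀) : ContDiffAt ℝ n (ptOf q) p := by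
  have hT : ContDiffAt ℝ n (fun p : Param ↦ p.2.2.2) p := by fun_prop
  have he : ContDiffAt ℝ n (fun p : Param ↦ q (p.1, p.2.1)) p :=
    ContDiffAt.comp p (g := q) (f := fun p : Param ↦ (p.1, p.2.1))
      (hq.contDiffAt n p.1 p.2.1 (mass_pos_of_mem hm₀ hp))
      (contDiffAt_fst.prodMk contDiffAt_snd.fst)
  show ContDiffAt ℝ n (fun p : Param ↦ p.2.2.2 (q (p.1, p.2.1))) p
  exact hT.clm_apply he

/-- `(p, x) ↦ G_p(x)` is smooth at `(p, x_p)` for windowed `p`. [folklore] -/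
theorem contDiffAt_fam_ptOf (hq : IsSlabPointMap q) {n : WithTop ℕ∞} {m₀ ρ₀ : ℝ} (hm₀ : 0 < m₀)
    {p : Param} (hp : p ∈ paramSet m₀ ρ₀) :
    ContDiffAt ℝ n (fun q : Param × E4 ↦ fam q.1 q.2) (p, ptOf q p) :=
  contDiffAt_fam (q := (p, ptOf q p)) (radius_ptOf_pos_of_mem hq hm₀ hp)

/-- `(p, x) ↦ DG_p(x)` is smooth at `(p, x_p)`. [folklore] -/
theorem contDiffAt_fderiv_fam_ptOf (hq : IsSlabPointMap q) {n : WithTop ℕ∞} {m₀ ρ₀ : ℝ}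
    (hm₀ : 0 < m₀) {p : Param} (hp : p ∈ paramSet m₀ ρ₀) :
    ContDiffAt ℝ n (fun q : Param × E4 ↦ fderiv ℝ (fam q.1) q.2) (p, ptOf q p) := by
  have h : ContDiffAt ℝ (n + 1) (uncurry fun (q : Param × E4) (x : E4) ↦ fam q.1 x)
      ((p, ptOf q p), ptOf q p) :=
    (contDiffAt_fam_ptOf hq (n := n + 1) hm₀ hp).comp ((p, ptOf q p), ptOf q p)
      (contDiffAt_fst.fst.prodMk contDiffAt_snd)
  exact h.fderiv contDiffAt_snd le_rfl

/-- `(p, x) ↦ D²G_p(x)` is smooth at `(p, x_p)`. [folklore] -/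
theorem contDiffAt_fderiv_fderiv_fam_ptOf (hq : IsSlabPointMap q) {n : WithTop ℕ∞} {m₀ ρ₀ : ℝ}
    (hm₀ : 0 < m₀) {p : Param} (hp : p ∈ paramSet m₀ ρ₀) :
    ContDiffAt ℝ n (fun q : Param × E4 ↦ fderiv ℝ (fderiv ℝ (fam q.1)) q.2) (p, ptOf q p) := by
  have h : ContDiffAt ℝ (n + 1) (uncurry fun (q : Param × E4) (x : E4) ↦ fderiv ℝ (fam q.1) x)
      ((p, ptOf q p), ptOf q p) :=
    (contDiffAt_fderiv_fam_ptOf hq (n := n + 1) hm₀ hp).comp ((p, ptOf q p), ptOf q p)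
      (contDiffAt_fst.fst.prodMk contDiffAt_snd)
  exact h.fderiv contDiffAt_snd le_rfl

/-- The `0`-jet is continuous at windowed parameters. [folklore] -/
theorem continuousAt_jetOf0 (hq : IsSlabPointMap q) {m₀ ρ₀ : ℝ} (hm₀ : 0 < m₀) {p : Param}
    (hp : p ∈ paramSet m₀ ρ₀) : ContinuousAt (jetOf0 q) p := by
  have h : ContDiffAt ℝ 0 (fun p : Param ↦ fam p (ptOf q p)) p :=
    ContDiffAt.comp p (g := fun q : Param × E4 ↦ fam q.1 q.2) (f := fun x : Param ↦ (x, ptOf q x))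
      (contDiffAt_fam_ptOf hq hm₀ hp) (contDiffAt_id.prodMk (contDiffAt_ptOf hq hm₀ hp))
  exact h.continuousAt

/-- The `1`-jet is continuous at windowed parameters. [folklore] -/
theorem continuousAt_jetOf1 (hq : IsSlabPointMap q) {m₀ ρ₀ : ℝ} (hm₀ : 0 < m₀) {p : Param}
    (hp : p ∈ paramSet m₀ ρ₀) : ContinuousAt (jetOf1 q) p := by
  have h : ContDiffAt ℝ 0 (fun p : Param ↦ fderiv ℝ (fam p) (ptOf q p)) p :=
    ContDiffAt.comp p (g := fun q : Param × E4 ↦ fderiv ℝ (fam q.1) q.2)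
      (f := fun x : Param ↦ (x, ptOf q x))
      (contDiffAt_fderiv_fam_ptOf hq hm₀ hp) (contDiffAt_id.prodMk (contDiffAt_ptOf hq hm₀ hp))
  exact h.continuousAt

/-- The `2`-jet is continuous at windowed parameters. [folklore] -/
theorem continuousAt_jetOf2 (hq : IsSlabPointMap q) {m₀ ρ₀ : ℝ} (hm₀ : 0 < m₀) {p : Param}
    (hp : p ∈ paramSet m₀ ρ₀) : ContinuousAt (jetOf2 q) p := by
  have h : ContDiffAt ℝ 0 (fun p : Param ↦ fderiv ℝ (fderiv ℝ (fam p)) (ptOf q p)) p :=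
    ContDiffAt.comp p (g := fun q : Param × E4 ↦ fderiv ℝ (fderiv ℝ (fam q.1)) q.2)
      (f := fun x : Param ↦ (x, ptOf q x))
      (contDiffAt_fderiv_fderiv_fam_ptOf hq hm₀ hp) (contDiffAt_id.prodMk (contDiffAt_ptOf hq hm₀ hp))
  exact h.continuousAt

/-- **The `0`-jet of a windowed parameter is invertible** (`Sᵀ g(q) S` with `g(q)` nondegenerate and
`S` invertible). [cite: KerrSchild1965, §3] -/
theorem isInvertible_jetOf0 (hq : IsSlabPointMap q) {m₀ ρ₀ : ℝ} (hm₀ : 0 < m₀) {p : Param}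
    (hp : p ∈ paramSet m₀ ρ₀) : (jetOf0 q p).IsInvertible := by
  have hK : (Kerr.bilin p.1 p.2.1 (p.2.2.1 (ptOf q p))).IsInvertible := by
    rw [apply_ptOf_of_mem hp]
    exact (KerrSchildChart.isMetricOn_kerrBilin p.1 p.2.1 p.1).isInvertible _
      (mem_region_of_isSlabPointMap hq hm₀ hp)
  have hS : (p.2.2.1).IsInvertible := ⟨linEquiv hp, coe_linEquiv hp⟩
  have hP : (ContinuousLinearMap.precomp ℝ p.2.2.1 : (E4 →L[ℝ] ℝ) →L[ℝ] (E4 →L[ℝ] ℝ)).IsInvertible :=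
    ⟨precompEquiv hp, coe_precompEquiv hp⟩
  exact hP.comp (hK.comp hS)

/-- The inverse of the `0`-jet is continuous at windowed parameters. [folklore] -/
theorem continuousAt_inverse_jetOf0 (hq : IsSlabPointMap q) {m₀ ρ₀ : ℝ} (hm₀ : 0 < m₀) {p : Param}
    (hp : p ∈ paramSet m₀ ρ₀) : ContinuousAt (fun p ↦ (jetOf0 q p).inverse) p :=
  ((isInvertible_jetOf0 hq hm₀ hp).contDiffAt_map_inverse (n := 0)).continuousAt.comp
    (continuousAt_jetOf0 hq hm₀ hp)

/-- **Uniform `C²` bound over the window** at the comparison points `x_p`. [folklore] -/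
theorem exists_jetOf_bound (hq : IsSlabPointMap q) {m₀ : ℝ} (hm₀ : 0 < m₀) (ρ₀ : ℝ) :
    ∃ N : ℝ, 1 ≤ N ∧ ∀ p ∈ paramSet m₀ ρ₀,
      ‖(jetOf0 q p).inverse‖ ≤ N ∧ ‖jetOf1 q p‖ ≤ N ∧ ‖jetOf2 q p‖ ≤ N := by
  have hc := isCompact_paramSet m₀ ρ₀
  obtain ⟨C₀, hC₀⟩ := hc.exists_bound_of_continuousOn (f := fun p ↦ (jetOf0 q p).inverse)
    fun p hp ↦ (continuousAt_inverse_jetOf0 hq hm₀ hp).continuousWithinAt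
  obtain ⟨C₁, hC₁⟩ := hc.exists_bound_of_continuousOn (f := jetOf1 q)
    fun p hp ↦ (continuousAt_jetOf1 hq hm₀ hp).continuousWithinAt
  obtain ⟨C₂, hC₂⟩ := hc.exists_bound_of_continuousOn (f := jetOf2 q)
    fun p hp ↦ (continuousAt_jetOf2 hq hm₀ hp).continuousWithinAt
  refine ⟨max 1 (max C₀ (max C₁ C₂)), le_max_left _ _, fun p hp ↦ ⟨?_, ?_, ?_⟩⟩
  · exact (hC₀ p hp).trans ((le_max_left _ _).trans (le_max_right _ _))
  · exact (hC₁ p hp).trans ((le_max_left _ _).trans ((le_max_right _ _).trans (le_max_right _ _)))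
  · exact (hC₂ p hp).trans ((le_max_right _ _).trans ((le_max_right _ _).trans (le_max_right _ _)))

/-- The equatorial point `y_e(M, a) = (0, √(4M² + a²), 0, 0)` is a slab point map. [folklore] -/
theorem isSlabPointMap_eqPoint : IsSlabPointMap fun Ma : ℝ × ℝ ↦ eqPoint Ma.1 Ma.2 where
  contDiffAt _ M a hM := contDiffAt_eqPoint (q := (M, a)) (by show 0 < 4 * M ^ 2 + a ^ 2; positivity)
  radius_gt M a hM := by
    show M < Kerr.radius a (eqPoint M a)
    rw [radius_eqPoint hM.le]; linarith
  radius_le M a hM := by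
    show Kerr.radius a (eqPoint M a) ≤ 3 * M
    rw [radius_eqPoint hM.le]; linarith
  time_eq M a := eqPoint_zero M a

end PointOf

section GeneralMain

open MetricCoord

set_option maxHeartbeats 1600000 in
/-- **CURVATURE TRACKING: A `C²`-QUIET WINDOWED KERR COLLAR READS THE HOST'S KRETSCHMANN SCALAR** at the
image of any rest-frame slab point map `q` with `M < r(q(M, a)) ≤ 3M`, `t*(q(M, a)) = 0`
(`IsSlabPointMap`; e.g. the equatorial point `eqPoint`, the axial point `axPoint`). For every label window
`m₀ > 0` and boost bound `ρ₀` there are `δ₁ > 0` and `A ≥ 0` such that for EVERY spacetime `𝓢` and every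
thick Kerr collar chart `Φ₁ : B₁.domain → 𝓢` modelled on the boosted Kerr star background
`B₁ = (Λ, c, M₁, a₁)` with `m₀ ≤ M₁ ≤ m₀⁻¹`, `|a₁| ≤ M₁`, `‖Λ‖, ‖Λ⁻¹‖ ≤ ρ₀`, smooth on the collar layer
`{−1 < t* < 1, r < 3M₁ + 1}` and `δ`-quiet in `C²` on the thick slab `{t* = 0, r ≤ 3M₁}`, `δ ≤ δ₁`:
`| |Rm|²_𝓢(Φ₁(Λ q(M₁,a₁) + c)) − |Rm|²_{g_{M₁,a₁}}(q(M₁,a₁)) | ≤ A δ`. UNCONDITIONAL (no closed form of the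
Kerr scalar is needed: naturality of `|Rm|²` under the Poincaré map). Proof: at `x_q = Λ q + c` the
components `F = Φ₁^* g` (read through `Φ₁ ∘ (chartAt E4 x)⁻¹`) and `g_B` have `δ`-close `2`-jets, both
bounded by one constant `N(m₀, ρ₀)` (`exists_jetOf_bound`, `exists_uniform_inverse_bound` over the compact
window), so `‖R_F − R_B‖ ≤ 42N⁵δ` (`norm_riemAt_sub_le`, Kotschwar 2014 (8)), `‖R_F‖, ‖R_B‖ ≤ 11N⁴`,
`‖♯_F − ♯_B‖ ≤ N²δ` and `| |Rm|²_F − |Rm|²_B | ≤ A(N)δ` (`abs_rmNormSqAt_sub_le`); `|Rm|²_F(x_q) = |Rm|²_𝓢(Φ₁ x_q)`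
by chart independence (`rmNormSqAt_metricInCoords_eq_kretschmannAt`) and `|Rm|²_B(x_q) = |Rm|²_{g}(q)` by
naturality. No open-embedding hypothesis is needed. [cite: Kotschwar2014, §1.1 (8)] -/
theorem abs_kretschmannAt_sub_rmNormSqAt_le {q : ℝ × ℝ → E4} (hq : IsSlabPointMap q)
    {m₀ : ℝ} (hm₀ : 0 < m₀) (ρ₀ : ℝ) :
    ∃ δ₁ A : ℝ, 0 < δ₁ ∧ 0 ≤ A ∧ ∀ (𝓢 : Spacetime 4) (M₁ a₁ : ℝ) (Λ : lorentzGroup) (c : E4)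
      (B : ModelBackground) (Φ₁ : B.domain → 𝓢.carrier) (δ : ℝ),
      m₀ ≤ M₁ → M₁ ≤ m₀⁻¹ → |a₁| ≤ M₁ →
      ‖((Λ : E4 ≃L[ℝ] E4) : E4 →L[ℝ] E4)‖ ≤ ρ₀ → ‖((Λ : E4 ≃L[ℝ] E4).symm : E4 →L[ℝ] E4)‖ ≤ ρ₀ →
      B = starBackground Λ c M₁ a₁ (fun x ↦ Kerr.radius a₁ (poincareInv Λ c x)) →
      ContMDiffOn 𝓘(ℝ, E4) (𝓡 4) ∞ Φ₁
        {x | -1 < B.time x.1 ∧ B.time x.1 < 1 ∧ B.radius x.1 < 3 * M₁ + 1} →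
      0 ≤ δ → δ ≤ δ₁ → 𝓢.truncDeviationCk B Φ₁ 2 (3 * M₁) 0 ≤ ENNReal.ofReal δ →
      ∀ x : B.domain, (x : E4) = (Λ : E4 ≃L[ℝ] E4) (q (M₁, a₁)) + c →
        |𝓢.kretschmannAt (Φ₁ x) - rmNormSqAt (Kerr.bilin M₁ a₁) (q (M₁, a₁))| ≤ A * δ := by
  -- uniform constants over the window
  obtain ⟨N, hN1, hN⟩ := exists_jetOf_bound hq hm₀ ρ₀
  have hKc : IsCompact (jetOf0 q '' paramSet m₀ ρ₀) :=
    (isCompact_paramSet m₀ ρ₀).image_of_continuousOn fun p hp ↦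
      (continuousAt_jetOf0 hq hm₀ hp).continuousWithinAt
  obtain ⟨δ₁, hδ₁, C, hC⟩ := exists_uniform_inverse_bound hKc
    (by rintro _ ⟨p, hp, rfl⟩; exact isInvertible_jetOf0 hq hm₀ hp)
  set N' : ℝ := max (N + 1) (max C 1) with hN'
  have hN'1 : 1 ≤ N' := le_trans (le_max_right C 1) (le_max_right _ _)
  have hNN' : N ≤ N' := by linarith [le_max_left (N + 1) (max C 1)]
  have hN1N' : N + 1 ≤ N' := le_max_left _ _
  have hCN' : C ≤ N' := (le_max_left C 1).trans (le_max_right _ _)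
  have hN'0 : 0 ≤ N' := zero_le_one.trans hN'1
  set A : ℝ := (4 : ℝ) ^ 4 * (4 * (2 * N' * (11 * N' ^ 4) ^ 2 * N' ^ 2
    + 2 * N' ^ 2 * (11 * N' ^ 4) * (42 * N' ^ 5))) with hA
  have hA0 : 0 ≤ A := by positivity
  refine ⟨min δ₁ 1, A, lt_min hδ₁ one_pos, hA0,
    fun 𝓢 M₁ a₁ Λ c B Φ₁ δ hlo hhi ha hΛ hΛ' hB hΦ hδ0 hδle hle x' hx' ↦ ?_⟩
  have hδ1 : δ ≤ 1 := hδle.trans (min_le_right _ _)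
  have hδδ₁ : δ ≤ δ₁ := hδle.trans (min_le_left _ _)
  -- the fields of the background
  have hbil : B.bilin = boostedKerrBilin Λ c M₁ a₁ := by rw [hB]; rfl
  have htimeF : B.time = fun x ↦ poincareInv Λ c x 0 := by rw [hB]; rfl
  have hradF : B.radius = fun x ↦ Kerr.radius a₁ (poincareInv Λ c x) := by rw [hB]; rfl
  have hdomF : (B.domain : Set E4) = poincareInv Λ c ⁻¹' (Kerr.region a₁ M₁ : Set E4) := by rw [hB]; rfl
  -- the parameter and the comparison point
  set p : Param := (M₁, a₁, ((Λ : E4 ≃L[ℝ] E4).symm : E4 →L[ℝ] E4), ((Λ : E4 ≃L[ℝ] E4) : E4 →L[ℝ] E4))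
    with hpdef
  have hp : p ∈ paramSet m₀ ρ₀ := mem_paramSet_of Λ hlo hhi ha hΛ hΛ'
  have hM : 0 < M₁ := hm₀.trans_le hlo
  set ye : E4 := q (M₁, a₁) with hye
  set xe : E4 := (Λ : E4 ≃L[ℝ] E4) ye + c with hxe
  have hpt : ptOf q p = (Λ : E4 ≃L[ℝ] E4) ye := rfl
  have hxc : xe - c = ptOf q p := by rw [hpt, hxe, add_sub_cancel_right]
  have hP : poincareInv Λ c xe = ye := by
    show (Λ : E4 ≃L[ℝ] E4).symm (xe - c) = ye
    rw [hxe, add_sub_cancel_right, ContinuousLinearEquiv.symm_apply_apply]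
  have hye_reg : ye ∈ (Kerr.region a₁ M₁ : Set E4) := mem_region_of_isSlabPointMap hq hm₀ hp
  have hxe_dom : xe ∈ (B.domain : Set E4) := by
    rw [hdomF]; show poincareInv Λ c xe ∈ (Kerr.region a₁ M₁ : Set E4); rw [hP]; exact hye_reg
  set x : B.domain := ⟨xe, hxe_dom⟩ with hxdef
  have hx'x : x' = x := Subtype.ext hx'
  rw [hx'x]
  have htime : B.time xe = 0 := by
    rw [htimeF]; show (poincareInv Λ c xe) 0 = 0; rw [hP]; exact hq.time_eq M₁ a₁
  have hrad : B.radius xe ≤ 3 * M₁ := by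
    rw [hradF]; show Kerr.radius a₁ (poincareInv Λ c xe) ≤ 3 * M₁; rw [hP]; exact hq.radius_le M₁ a₁ hM
  set L : Set B.domain := {x | -1 < B.time x.1 ∧ B.time x.1 < 1 ∧ B.radius x.1 < 3 * M₁ + 1} with hLdef
  have hL : IsOpen L := isOpen_layer Λ c a₁ (3 * M₁ + 1) htimeF hradF
  have hxL : x ∈ L := by
    refine ⟨?_, ?_, ?_⟩
    · show -1 < B.time xe; rw [htime]; norm_num
    · show B.time xe < 1; rw [htime]; norm_num
    · show B.radius xe < 3 * M₁ + 1; linarith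
  have hslab : x ∈ B.truncTimeSlab (3 * M₁) 0 := ⟨htime, hrad⟩
  have hxeW₀ : xe ∈ (Subtype.val '' L : Set E4) := mem_image_of_mem Subtype.val hxL
  -- the jets of the deviation at `xe` are `≤ δ`
  have hjet : ∀ m ≤ 2, ‖iteratedFDeriv ℝ m (𝓢.deviationExtend B Φ₁) xe‖ ≤ δ := by
    intro m hm
    have h := enorm_iteratedFDeriv_le_supCkENorm hm (mem_image_of_mem Subtype.val hslab)
      (𝓢.deviationExtend B Φ₁)
    have h2 : ‖iteratedFDeriv ℝ m (𝓢.deviationExtend B Φ₁) xe‖ₑ ≤ ENNReal.ofReal δ := h.trans hle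
    rwa [← ofReal_norm, ENNReal.ofReal_le_ofReal_iff hδ0] at h2
  have hd0 : ‖𝓢.deviationExtend B Φ₁ xe‖ ≤ δ := by
    have h := hjet 0 (by norm_num); rwa [norm_iteratedFDeriv_zero] at h
  have hd1 : ‖fderiv ℝ (𝓢.deviationExtend B Φ₁) xe‖ ≤ δ := by
    have h := hjet 1 (by norm_num)
    rwa [← norm_iteratedFDeriv_fderiv (n := 0), norm_iteratedFDeriv_zero] at h
  have hd2 : ‖fderiv ℝ (fderiv ℝ (𝓢.deviationExtend B Φ₁)) xe‖ ≤ δ := by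
    have h := hjet 2 le_rfl
    rwa [← norm_iteratedFDeriv_fderiv (n := 1), ← norm_iteratedFDeriv_fderiv (n := 0),
      norm_iteratedFDeriv_zero] at h
  -- the background components and their jets at `xe`
  have hGfam : B.bilin = fun y ↦ fam p (y - c) := by
    rw [hbil]; exact funext (boostedKerrBilin_eq_fam Λ c M₁ a₁)
  have hG0 : B.bilin xe = jetOf0 q p := by
    rw [hGfam]; show fam p (xe - c) = fam p (ptOf q p); rw [hxc]
  have hG1 : fderiv ℝ B.bilin xe = jetOf1 q p := by
    rw [hGfam, fderiv_comp_sub_const']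
    show fderiv ℝ (fam p) (xe - c) = fderiv ℝ (fam p) (ptOf q p); rw [hxc]
  have hG2 : fderiv ℝ (fderiv ℝ B.bilin) xe = jetOf2 q p := by
    rw [hGfam, fderiv_comp_sub_const', fderiv_comp_sub_const' (fderiv ℝ (fam p)) c]
    show fderiv ℝ (fderiv ℝ (fam p)) (xe - c) = fderiv ℝ (fderiv ℝ (fam p)) (ptOf q p); rw [hxc]
  obtain ⟨hNinv, hNj1, hNj2⟩ := hN p hp
  have hGm : IsMetricOn B.bilin (B.domain : Set E4) := by
    have h := (KerrSchildChart.isMetricOn_kerrBilin M₁ a₁ M₁).isMetricOn_pullMetric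
      (isCoordChangeOn_poincareInv_region Λ c a₁ M₁)
    rw [← KerrSchildChart.boostedKerrBilin_eq_pullMetric Λ c M₁ a₁] at h
    rw [hbil, hdomF]
    exact h
  have hBsm : ∀ y ∈ (Subtype.val '' L : Set E4), ContDiffAt ℝ ∞ B.bilin y := by
    rintro _ ⟨z, _, rfl⟩
    exact (hGm.contDiffOn z.1 z.2).contDiffAt (B.domain.isOpen.mem_nhds z.2)
  -- the chart components and the jets of the deviation as differences
  set F := 𝓢.metricInCoords (Φ₁ ∘ (chartAt E4 x).symm) with hFdef
  have hψsm : ContMDiffOn 𝓘(ℝ, E4) (𝓡 4) ∞ (Φ₁ ∘ (chartAt E4 x).symm) (Subtype.val '' L) :=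
    contMDiffOn_comp_chartAt_symm_image hΦ x
  have hO : IsOpen (Subtype.val '' L : Set E4) := isOpen_image_val hL
  have hFsmO : ContDiffOn ℝ ∞ F (Subtype.val '' L) := 𝓢.contDiffOn_metricInCoords hO hψsm
  obtain ⟨e0, e1, e2⟩ := jets_deviationExtend_general hΦ hL x hBsm hxeW₀
  have hc0 : ‖B.bilin xe - F xe‖ ≤ δ := by
    rw [norm_sub_rev, ← e0]; exact hd0
  have hc1 : ‖fderiv ℝ B.bilin xe - fderiv ℝ F xe‖ ≤ δ := by
    rw [norm_sub_rev, ← e1]; exact hd1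
  have hc2 : ‖fderiv ℝ (fderiv ℝ B.bilin) xe - fderiv ℝ (fderiv ℝ F) xe‖ ≤ δ := by
    rw [norm_sub_rev, ← e2]; exact hd2
  -- the chart components are nondegenerate at `xe`, with inverse bounded by `C`
  have hG'inv : (F xe).IsInvertible ∧ ‖(F xe).inverse‖ ≤ C := by
    refine hC (jetOf0 q p) (mem_image_of_mem (jetOf0 q) hp) (F xe) ?_
    rw [← hG0, ← norm_sub_rev]; exact hc0.trans hδδ₁
  -- `|Rm|²` of the chart components at `xe` is the Kretschmann scalar of `𝓢` at `Φ₁ x`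
  have hKF : rmNormSqAt F xe = 𝓢.kretschmannAt (Φ₁ x) := by
    have h := 𝓢.rmNormSqAt_metricInCoords_eq_kretschmannAt hO hψsm hxeW₀ hG'inv.1
    have hxx : (Φ₁ ∘ (chartAt E4 x).symm) xe = Φ₁ x := comp_chartAt_symm_apply_coe x x
    rw [hFdef, h, hxx]
  -- the open set of smooth nondegenerate chart points around `xe`
  set W : Set E4 := (Subtype.val '' L : Set E4) ∩ F ⁻¹' {T | T.IsInvertible} with hWdef
  have hW : IsOpen W :=
    hFsmO.continuousOn.isOpen_inter_preimage hO isOpen_setOf_isInvertible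
  have hxeW : xe ∈ W := ⟨hxeW₀, hG'inv.1⟩
  have hWL : W ⊆ (Subtype.val '' L : Set E4) := inter_subset_left
  have hWdom : W ⊆ (B.domain : Set E4) := fun y hy ↦ by
    obtain ⟨z, _, rfl⟩ := hWL hy; exact z.2
  have hG'm : IsMetricOn F W :=
    { isOpen := hW
      contDiffOn := hFsmO.mono hWL
      symm := fun y _ v w ↦ 𝓢.metricInCoords_symm _ y v w
      isInvertible := fun y hy ↦ hy.2 }
  have hGmW : IsMetricOn B.bilin W := KerrSchildChart.isMetricOn_mono hGm hW hWdom
  -- the bounds fed to the perturbation estimates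
  have hs : ‖sharpAt B.bilin xe‖ ≤ N' := by
    show ‖(B.bilin xe).inverse‖ ≤ N'; rw [hG0]; exact hNinv.trans hNN'
  have hs' : ‖sharpAt F xe‖ ≤ N' := hG'inv.2.trans hCN'
  have h1 : ‖fderiv ℝ B.bilin xe‖ ≤ N' := by rw [hG1]; exact hNj1.trans hNN'
  have h1' : ‖fderiv ℝ F xe‖ ≤ N' := by
    have : ‖fderiv ℝ F xe‖ ≤ ‖fderiv ℝ B.bilin xe‖ + δ := by
      calc ‖fderiv ℝ F xe‖
          = ‖fderiv ℝ B.bilin xe - (fderiv ℝ B.bilin xe - fderiv ℝ F xe)‖ := by rw [sub_sub_cancel]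
        _ ≤ ‖fderiv ℝ B.bilin xe‖ + ‖fderiv ℝ B.bilin xe - fderiv ℝ F xe‖ := norm_sub_le _ _
        _ ≤ ‖fderiv ℝ B.bilin xe‖ + δ := by gcongr
    rw [hG1] at this
    linarith
  have h2 : ‖fderiv ℝ (fderiv ℝ B.bilin) xe‖ ≤ N' := by rw [hG2]; exact hNj2.trans hNN'
  have h2' : ‖fderiv ℝ (fderiv ℝ F) xe‖ ≤ N' := by
    have : ‖fderiv ℝ (fderiv ℝ F) xe‖ ≤ ‖fderiv ℝ (fderiv ℝ B.bilin) xe‖ + δ := by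
      calc ‖fderiv ℝ (fderiv ℝ F) xe‖
          = ‖fderiv ℝ (fderiv ℝ B.bilin) xe
              - (fderiv ℝ (fderiv ℝ B.bilin) xe - fderiv ℝ (fderiv ℝ F) xe)‖ := by rw [sub_sub_cancel]
        _ ≤ ‖fderiv ℝ (fderiv ℝ B.bilin) xe‖
              + ‖fderiv ℝ (fderiv ℝ B.bilin) xe - fderiv ℝ (fderiv ℝ F) xe‖ := norm_sub_le _ _
        _ ≤ ‖fderiv ℝ (fderiv ℝ B.bilin) xe‖ + δ := by gcongr
    rw [hG2] at this
    linarith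
  -- curvature bounds: both `≤ 11 N'⁴`, difference `≤ 42 N'⁵ δ`, `♯`-difference `≤ N'² δ`
  have hRB : ∀ X Y Z : E4, ‖riemAt B.bilin xe X Y Z‖ ≤ 11 * N' ^ 4 * ‖X‖ * ‖Y‖ * ‖Z‖ :=
    hGmW.norm_riemAt_apply_le_of_jets hxeW hN'1 hs h1 h2
  have hRF : ∀ X Y Z : E4, ‖riemAt F xe X Y Z‖ ≤ 11 * N' ^ 4 * ‖X‖ * ‖Y‖ * ‖Z‖ :=
    hG'm.norm_riemAt_apply_le_of_jets hxeW hN'1 hs' h1' h2'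
  have hsharp : ‖sharpAt B.bilin xe - sharpAt F xe‖ ≤ N' ^ 2 * δ := by
    have h := norm_sharpAt_sub_le (hGmW.isInvertible xe hxeW) (hG'm.isInvertible xe hxeW)
    calc _ ≤ ‖sharpAt B.bilin xe‖ * ‖B.bilin xe - F xe‖ * ‖sharpAt F xe‖ := h
      _ ≤ N' * δ * N' := by gcongr
      _ = N' ^ 2 * δ := by ring
  have hdR : ∀ X Y Z : E4, ‖riemAt B.bilin xe X Y Z - riemAt F xe X Y Z‖ ≤
      42 * N' ^ 5 * δ * ‖X‖ * ‖Y‖ * ‖Z‖ := by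
    intro X Y Z
    have hmain := hGmW.norm_riemAt_sub_le hG'm hxeW hN'1 hs hs' h1 h1' h2 X Y Z
    have hN1 : (1 : ℝ) ≤ N' ^ 2 := one_le_pow₀ hN'1
    calc ‖riemAt B.bilin xe X Y Z - riemAt F xe X Y Z‖
        ≤ N' ^ 3 * (21 * ‖sharpAt B.bilin xe - sharpAt F xe‖ + 18 * ‖fderiv ℝ B.bilin xe - fderiv ℝ F xe‖
            + 3 * ‖fderiv ℝ (fderiv ℝ B.bilin) xe - fderiv ℝ (fderiv ℝ F) xe‖) * ‖X‖ * ‖Y‖ * ‖Z‖ := hmain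
      _ ≤ N' ^ 3 * (21 * (N' ^ 2 * δ) + 18 * (N' ^ 2 * δ) + 3 * (N' ^ 2 * δ)) * ‖X‖ * ‖Y‖ * ‖Z‖ := by
          gcongr
          · calc ‖fderiv ℝ B.bilin xe - fderiv ℝ F xe‖ ≤ δ := hc1
              _ = 1 * δ := (one_mul δ).symm
              _ ≤ N' ^ 2 * δ := by gcongr
          · calc ‖fderiv ℝ (fderiv ℝ B.bilin) xe - fderiv ℝ (fderiv ℝ F) xe‖ ≤ δ := hc2
              _ = 1 * δ := (one_mul δ).symm
              _ ≤ N' ^ 2 * δ := by gcongr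
      _ = 42 * N' ^ 5 * δ * ‖X‖ * ‖Y‖ * ‖Z‖ := by ring
  have key := abs_rmNormSqAt_sub_le (EuclideanSpace.basisFun (Fin 4) ℝ) (G := B.bilin) (G' := F)
    (x := xe) (ρ := 11 * N' ^ 4) (s := N') (εs := N' ^ 2 * δ) (ερ := 42 * N' ^ 5 * δ)
    (by positivity) (by positivity) (by positivity) hs hs' hRB hRF hsharp hdR
  -- the Kerr value at the rest-frame point (naturality under the Poincaré map)
  have hval : rmNormSqAt B.bilin xe = rmNormSqAt (Kerr.bilin M₁ a₁) ye := by
    have hG : B.bilin = pullMetric (Kerr.bilin M₁ a₁) (poincareInv Λ c) := by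
      rw [hbil]; exact KerrSchildChart.boostedKerrBilin_eq_pullMetric Λ c M₁ a₁
    have hxe_dom' : xe ∈ poincareInv Λ c ⁻¹' (Kerr.region a₁ M₁ : Set E4) := by rw [← hdomF]; exact hxe_dom
    rw [hG, rmNormSqAt_pullMetric (KerrSchildChart.isMetricOn_kerrBilin M₁ a₁ M₁)
      (isCoordChangeOn_poincareInv_region Λ c a₁ M₁) hxe_dom', hP]
  -- numerics
  have hcard : (Fintype.card (Fin 4) : ℝ) = 4 := by norm_num
  have hrank : (Module.finrank ℝ E4 : ℝ) = 4 := by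
    rw [finrank_euclideanSpace_fin]; norm_num
  have hup : (4 : ℝ) ^ 4 * (4 * (2 * N' * (11 * N' ^ 4) ^ 2 * (N' ^ 2 * δ)
      + 2 * N' ^ 2 * (11 * N' ^ 4) * (42 * N' ^ 5 * δ))) = A * δ := by rw [hA]; ring
  rw [hcard, hrank, hval, hKF, hup] at key
  rwa [abs_sub_comm] at key


/-- **MASS TRACKING** (the equatorial instance, given the closed form of the Kretschmann scalar of Kerr,
named fact `Kerr.kretschmannScalar_closedForm`, hypothesis `hQ`): under the hypotheses of
`abs_kretschmannAt_sub_rmNormSqAt_le` at the equatorial point `x_e = Λ(0, √(4M₁² + a₁²), 0, 0) + c`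
(`t* = 0`, `r = 2M₁`, `x₃ = 0`), the host's Kretschmann scalar is within `A·δ` of the Kerr value
`48M₁²/(2M₁)⁶ = ¾M₁⁻⁴` — the MASS LABEL of a quiet windowed collar is determined by the host's curvature at
one image point up to `O(δ)` (Visser arXiv:0706.0622 §3). [cite: arXiv07060622, §3] -/
theorem abs_kretschmannAt_sub_le_of_truncDeviationCk_le
    (hQ : Kerr.kretschmannScalar_closedForm)
    {m₀ : ℝ} (hm₀ : 0 < m₀) (ρ₀ : ℝ) :
    ∃ δ₁ A : ℝ, 0 < δ₁ ∧ 0 ≤ A ∧ ∀ (𝓢 : Spacetime 4) (M₁ a₁ : ℝ) (Λ : lorentzGroup) (c : E4)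
      (B : ModelBackground) (Φ₁ : B.domain → 𝓢.carrier) (δ : ℝ),
      m₀ ≤ M₁ → M₁ ≤ m₀⁻¹ → |a₁| ≤ M₁ →
      ‖((Λ : E4 ≃L[ℝ] E4) : E4 →L[ℝ] E4)‖ ≤ ρ₀ → ‖((Λ : E4 ≃L[ℝ] E4).symm : E4 →L[ℝ] E4)‖ ≤ ρ₀ →
      B = starBackground Λ c M₁ a₁ (fun x ↦ Kerr.radius a₁ (poincareInv Λ c x)) →
      ContMDiffOn 𝓘(ℝ, E4) (𝓡 4) ∞ Φ₁
        {x | -1 < B.time x.1 ∧ B.time x.1 < 1 ∧ B.radius x.1 < 3 * M₁ + 1} →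
      0 ≤ δ → δ ≤ δ₁ → 𝓢.truncDeviationCk B Φ₁ 2 (3 * M₁) 0 ≤ ENNReal.ofReal δ →
      ∀ x : B.domain, (x : E4) = (Λ : E4 ≃L[ℝ] E4) (eqPoint M₁ a₁) + c →
        |𝓢.kretschmannAt (Φ₁ x) - 48 * M₁ ^ 2 / (2 * M₁) ^ 6| ≤ A * δ := by
  obtain ⟨δ₁, A, hδ₁, hA0, H⟩ := abs_kretschmannAt_sub_rmNormSqAt_le isSlabPointMap_eqPoint hm₀ ρ₀
  refine ⟨δ₁, A, hδ₁, hA0, fun 𝓢 M₁ a₁ Λ c B Φ₁ δ hlo hhi ha hΛ hΛ' hB hΦ hδ0 hδle hle x hx ↦ ?_⟩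
  have hM : 0 < M₁ := hm₀.trans_le hlo
  have hr : 0 < Kerr.radius a₁ (eqPoint M₁ a₁) := by rw [radius_eqPoint hM.le]; positivity
  have hval : rmNormSqAt (Kerr.bilin M₁ a₁) (eqPoint M₁ a₁) = 48 * M₁ ^ 2 / (2 * M₁) ^ 6 := by
    rw [Kerr.kretschmannScalar_equatorial hQ M₁ a₁ hr (eqPoint_three M₁ a₁), radius_eqPoint hM.le]
  rw [← hval]
  exact H 𝓢 M₁ a₁ Λ c B Φ₁ δ hlo hhi ha hΛ hΛ' hB hΦ hδ0 hδle hle x hx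

/-- **Corollary: windowed quiet Kerr collars LOCALISE to the strong-field region.** For every label window
`m₀ > 0` and boost bound `ρ₀` there is `δ₀ > 0` such that a thick Kerr collar chart of ANY spacetime `𝓢`
(windowed label, bounded boost, smooth on the collar layer) whose image of the equatorial slab point `x_e`
has `|kretschmannAt 𝓢 (Φ₁ x_e)| ≤ (3/8) m₀⁴` is NOT `δ₀`-quiet in `C²` on the thick slab: by mass tracking
the host value is within `Aδ₀ < (3/8)m₀⁴` of `¾M₁⁻⁴ ≥ ¾m₀⁴`. Reading for crux `GenericCensorshipCollarMargin`
(stmt-FinalStateConjecture-10809, line `hair-vacates-the-margin`): the far field, the radiation zone and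
flat space (`FlatQuietCollarExclusion.lean`) present no windowed quiet collars. [cite: arXiv07060622, §3] -/
theorem truncDeviationCk_gt_of_kretschmannAt_le
    (hQ : Kerr.kretschmannScalar_closedForm)
    {m₀ : ℝ} (hm₀ : 0 < m₀) (ρ₀ : ℝ) :
    ∃ δ₀ : ℝ, 0 < δ₀ ∧ ∀ (𝓢 : Spacetime 4) (M₁ a₁ : ℝ) (Λ : lorentzGroup) (c : E4)
      (B : ModelBackground) (Φ₁ : B.domain → 𝓢.carrier),
      m₀ ≤ M₁ → M₁ ≤ m₀⁻¹ → |a₁| ≤ M₁ →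
      ‖((Λ : E4 ≃L[ℝ] E4) : E4 →L[ℝ] E4)‖ ≤ ρ₀ → ‖((Λ : E4 ≃L[ℝ] E4).symm : E4 →L[ℝ] E4)‖ ≤ ρ₀ →
      B = starBackground Λ c M₁ a₁ (fun x ↦ Kerr.radius a₁ (poincareInv Λ c x)) →
      ContMDiffOn 𝓘(ℝ, E4) (𝓡 4) ∞ Φ₁
        {x | -1 < B.time x.1 ∧ B.time x.1 < 1 ∧ B.radius x.1 < 3 * M₁ + 1} →
      (∀ x : B.domain, (x : E4) = (Λ : E4 ≃L[ℝ] E4) (eqPoint M₁ a₁) + c →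
        |𝓢.kretschmannAt (Φ₁ x)| ≤ 3 / 8 * m₀ ^ 4) →
      ENNReal.ofReal δ₀ < 𝓢.truncDeviationCk B Φ₁ 2 (3 * M₁) 0 := by
  obtain ⟨δ₁, A, hδ₁, hA0, H⟩ := abs_kretschmannAt_sub_le_of_truncDeviationCk_le hQ hm₀ ρ₀
  set δ₀ : ℝ := min δ₁ (3 / 8 * m₀ ^ 4 / (A + 1)) with hδ₀
  have hδ₀pos : 0 < δ₀ := lt_min hδ₁ (by positivity)
  have hδ₀δ₁ : δ₀ ≤ δ₁ := min_le_left _ _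
  have hδ₀A : δ₀ ≤ 3 / 8 * m₀ ^ 4 / (A + 1) := min_le_right _ _
  refine ⟨δ₀, hδ₀pos, fun 𝓢 M₁ a₁ Λ c B Φ₁ hlo hhi ha hΛ hΛ' hB hΦ hKr ↦ ?_⟩
  by_contra hnot
  have hle : 𝓢.truncDeviationCk B Φ₁ 2 (3 * M₁) 0 ≤ ENNReal.ofReal δ₀ := not_lt.1 hnot
  have hM : 0 < M₁ := hm₀.trans_le hlo
  -- the equatorial point is a point of the domain
  have hdomF : (B.domain : Set E4) = poincareInv Λ c ⁻¹' (Kerr.region a₁ M₁ : Set E4) := by rw [hB]; rfl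
  set xe : E4 := (Λ : E4 ≃L[ℝ] E4) (eqPoint M₁ a₁) + c with hxe
  have hP : poincareInv Λ c xe = eqPoint M₁ a₁ := by
    show (Λ : E4 ≃L[ℝ] E4).symm (xe - c) = eqPoint M₁ a₁
    rw [hxe, add_sub_cancel_right, ContinuousLinearEquiv.symm_apply_apply]
  have hxe_dom : xe ∈ (B.domain : Set E4) := by
    rw [hdomF]; show poincareInv Λ c xe ∈ (Kerr.region a₁ M₁ : Set E4); rw [hP]
    exact eqPoint_mem_region hm₀ (mem_paramSet_of Λ hlo hhi ha hΛ hΛ')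
  have htrack := H 𝓢 M₁ a₁ Λ c B Φ₁ δ₀ hlo hhi ha hΛ hΛ' hB hΦ hδ₀pos.le hδ₀δ₁ hle ⟨xe, hxe_dom⟩ rfl
  have hKx := hKr ⟨xe, hxe_dom⟩ rfl
  -- `¾m₀⁴ ≤ ¾M₁⁻⁴ ≤ |K| + Aδ₀ ≤ (3/8)m₀⁴ + Aδ₀` and `Aδ₀ < (3/8)m₀⁴`
  have hM4 : 48 * M₁ ^ 2 / (2 * M₁) ^ 6 = 3 / 4 * (M₁ ^ 4)⁻¹ := by
    field_simp; ring
  have hlow : 3 / 4 * m₀ ^ 4 ≤ 48 * M₁ ^ 2 / (2 * M₁) ^ 6 := by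
    rw [hM4]
    have hm4 : M₁ ^ 4 ≤ (m₀ ^ 4)⁻¹ := by
      rw [← inv_pow]; exact pow_le_pow_left₀ hM.le hhi 4
    have : m₀ ^ 4 ≤ (M₁ ^ 4)⁻¹ := by
      rw [le_inv_comm₀ (by positivity) (by positivity)]; exact hm4
    linarith
  have habs : 48 * M₁ ^ 2 / (2 * M₁) ^ 6 ≤ 3 / 8 * m₀ ^ 4 + A * δ₀ := by
    have h1 := abs_sub_abs_le_abs_sub (48 * M₁ ^ 2 / (2 * M₁) ^ 6) (𝓢.kretschmannAt (Φ₁ ⟨xe, hxe_dom⟩))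
    have h2 : |48 * M₁ ^ 2 / (2 * M₁) ^ 6| = 48 * M₁ ^ 2 / (2 * M₁) ^ 6 := abs_of_nonneg (by positivity)
    rw [abs_sub_comm] at htrack
    linarith
  have hδA : A * δ₀ < 3 / 8 * m₀ ^ 4 := by
    have h2 : A * δ₀ ≤ A * (3 / 8 * m₀ ^ 4 / (A + 1)) := mul_le_mul_of_nonneg_left hδ₀A hA0
    have h3 : A * (3 / 8 * m₀ ^ 4 / (A + 1)) < 3 / 8 * m₀ ^ 4 := by
      rw [mul_div_assoc', div_lt_iff₀ (by positivity)]
      have hm : 0 < 3 / 8 * m₀ ^ 4 := by positivity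
      nlinarith
    linarith
  linarith

/-- **Slab form** of `truncDeviationCk_gt_of_kretschmannAt_le`: a windowed, bounded-boost thick Kerr
collar chart of ANY spacetime whose whole thick slab `{t* = 0, r ≤ 3M₁}` is mapped into the region
`{|Rm|² ≤ (3/8) m₀⁴}` has `C²`-deviation `> δ₀(m₀, ρ₀)` — windowed quiet collars localise to the
strong-field region. [cite: arXiv07060622, §3] -/
theorem truncDeviationCk_gt_of_kretschmannAt_le_on_slab
    (hQ : Kerr.kretschmannScalar_closedForm)
    {m₀ : ℝ} (hm₀ : 0 < m₀) (ρ₀ : ℝ) :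
    ∃ δ₀ : ℝ, 0 < δ₀ ∧ ∀ (𝓢 : Spacetime 4) (M₁ a₁ : ℝ) (Λ : lorentzGroup) (c : E4)
      (B : ModelBackground) (Φ₁ : B.domain → 𝓢.carrier),
      m₀ ≤ M₁ → M₁ ≤ m₀⁻¹ → |a₁| ≤ M₁ →
      ‖((Λ : E4 ≃L[ℝ] E4) : E4 →L[ℝ] E4)‖ ≤ ρ₀ → ‖((Λ : E4 ≃L[ℝ] E4).symm : E4 →L[ℝ] E4)‖ ≤ ρ₀ →
      B = starBackground Λ c M₁ a₁ (fun x ↦ Kerr.radius a₁ (poincareInv Λ c x)) →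
      ContMDiffOn 𝓘(ℝ, E4) (𝓡 4) ∞ Φ₁
        {x | -1 < B.time x.1 ∧ B.time x.1 < 1 ∧ B.radius x.1 < 3 * M₁ + 1} →
      (∀ x ∈ B.truncTimeSlab (3 * M₁) 0, |𝓢.kretschmannAt (Φ₁ x)| ≤ 3 / 8 * m₀ ^ 4) →
      ENNReal.ofReal δ₀ < 𝓢.truncDeviationCk B Φ₁ 2 (3 * M₁) 0 := by
  obtain ⟨δ₀, hδ₀, H⟩ := truncDeviationCk_gt_of_kretschmannAt_le hQ hm₀ ρ₀
  refine ⟨δ₀, hδ₀, fun 𝓢 M₁ a₁ Λ c B Φ₁ hlo hhi ha hΛ hΛ' hB hΦ hK ↦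
    H 𝓢 M₁ a₁ Λ c B Φ₁ hlo hhi ha hΛ hΛ' hB hΦ fun x hx ↦ hK x ?_⟩
  -- the equatorial point lies on the thick slab `{t* = 0, r ≤ 3M₁}`
  have hM : 0 < M₁ := hm₀.trans_le hlo
  have hP : poincareInv Λ c x = eqPoint M₁ a₁ := by
    show (Λ : E4 ≃L[ℝ] E4).symm ((x : E4) - c) = eqPoint M₁ a₁
    rw [hx, add_sub_cancel_right, ContinuousLinearEquiv.symm_apply_apply]
  have htimeF : B.time = fun x ↦ poincareInv Λ c x 0 := by rw [hB]; rfl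
  have hradF : B.radius = fun x ↦ Kerr.radius a₁ (poincareInv Λ c x) := by rw [hB]; rfl
  refine ⟨?_, ?_⟩
  · show B.time x = 0
    rw [htimeF]; show (poincareInv Λ c x) 0 = 0; rw [hP]; exact eqPoint_zero M₁ a₁
  · show B.radius x ≤ 3 * M₁
    rw [hradF]; show Kerr.radius a₁ (poincareInv Λ c x) ≤ 3 * M₁
    rw [hP, radius_eqPoint hM.le]; linarith

end GeneralMain

/-! ## Part H: the axial point — quiet RAPIDLY ROTATING collars need NEGATIVE Kretschmann at the pole -/

section Axial

open MetricCoord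

/-- The rest-frame AXIAL slab point `y_ax(M, a) = (0, 0, 0, 2M) = 2M · ∂₃` (`t* = 0`, `r = 2M`,
`cos θ = x₃/r = 1`). [folklore] -/
def axPoint (M : ℝ) : E4 := (2 * M) • EuclideanSpace.single (3 : Fin 4) (1 : ℝ)

/-- Coordinates of the axial point. [folklore] -/
theorem axPoint_apply (M : ℝ) (μ : Fin 4) : axPoint M μ = if μ = 3 then 2 * M else 0 := by
  simp only [axPoint, PiLp.smul_apply, PiLp.single_apply, smul_eq_mul, mul_ite, mul_one, mul_zero]

/-- The axial point has `x₃ = 2M`. [folklore] -/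
theorem axPoint_three (M : ℝ) : axPoint M 3 = 2 * M := by
  rw [axPoint_apply]; simp

/-- The axial point has `t = 0`. [folklore] -/
theorem axPoint_zero (M : ℝ) : axPoint M 0 = 0 := by
  rw [axPoint_apply]; simp

/-- `ρ² = 4M²` at the axial point. [folklore] -/
theorem spatialNorm_sq_axPoint (M : ℝ) : E4.spatialNorm (axPoint M) ^ 2 = (2 * M) ^ 2 := by
  rw [E4.spatialNorm_sq, axPoint_apply, axPoint_apply, axPoint_apply]
  simp only [Fin.isValue, ↓reduceIte, Fin.reduceEq]
  ring

/-- **`r(y_ax) = 2M`** for `M ≥ 0` (on the axis Visser's quartic `r⁴ − (ρ² − a²)r² − a²z² = 0` with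
`ρ = |z|` gives `r = |z|`). [cite: arXiv07060622, (35)] -/
theorem radius_axPoint {M : ℝ} (hM : 0 ≤ M) (a : ℝ) : Kerr.radius a (axPoint M) = 2 * M := by
  unfold Kerr.radius
  rw [spatialNorm_sq_axPoint, axPoint_three]
  have h2 : ((2 * M) ^ 2 - a ^ 2) ^ 2 + 4 * a ^ 2 * (2 * M) ^ 2 = ((2 * M) ^ 2 + a ^ 2) ^ 2 := by ring
  rw [h2, Real.sqrt_sq (by positivity)]
  have h3 : ((2 * M) ^ 2 - a ^ 2 + ((2 * M) ^ 2 + a ^ 2)) / 2 = (2 * M) ^ 2 := by ring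
  rw [h3, Real.sqrt_sq (by positivity)]

/-- `(M, a) ↦ y_ax(M, a)` is smooth (linear). [folklore] -/
theorem contDiff_axPoint {n : WithTop ℕ∞} : ContDiff ℝ n (fun q : ℝ × ℝ ↦ axPoint q.1) := by
  unfold axPoint
  exact (contDiff_const.mul contDiff_fst).smul contDiff_const

/-- The axial point is a slab point map. [folklore] -/
theorem isSlabPointMap_axPoint : IsSlabPointMap fun Ma : ℝ × ℝ ↦ axPoint Ma.1 where
  contDiffAt _ _ _ _ := contDiff_axPoint.contDiffAt
  radius_gt M a hM := by
    show M < Kerr.radius a (axPoint M)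
    rw [radius_axPoint hM.le]; linarith
  radius_le M a hM := by
    show Kerr.radius a (axPoint M) ≤ 3 * M
    rw [radius_axPoint hM.le]; linarith
  time_eq M _ := axPoint_zero M

/-- `Re (x + iy)⁶ = x⁶ − 15x⁴y² + 15x²y⁴ − y⁶`. [folklore] -/
theorem re_add_mul_I_pow_six (x y : ℝ) :
    (((x : ℂ) + (y : ℂ) * Complex.I) ^ 6).re = x ^ 6 - 15 * x ^ 4 * y ^ 2 + 15 * x ^ 2 * y ^ 4 - y ^ 6 := by
  set z : ℂ := (x : ℂ) + (y : ℂ) * Complex.I with hz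
  have h6 : z ^ 6 = z * z * z * z * z * z := by ring
  have hre : z.re = x := by simp [hz]
  have him : z.im = y := by simp [hz]
  rw [h6]
  simp only [Complex.mul_re, Complex.mul_im, hre, him]
  ring

/-- **The Kretschmann scalar of Kerr at the axial point** (given the closed form, hypothesis `hQ`):
`|Rm|²(y_ax) = 48M² Re[(2M + ia)⁶]/((2M)² + a²)⁶`, `Re[(2M + ia)⁶] = (2M)⁶ − 15(2M)⁴a² + 15(2M)²a⁴ − a⁶`
(`cos θ = 1` on the axis). [cite: arXiv07060622, §3] -/
theorem kretschmann_axPoint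
    (hQ : Kerr.kretschmannScalar_closedForm)
    {M : ℝ} (hM : 0 < M) (a : ℝ) :
    rmNormSqAt (Kerr.bilin M a) (axPoint M) =
      48 * M ^ 2 * ((2 * M) ^ 6 - 15 * (2 * M) ^ 4 * a ^ 2 + 15 * (2 * M) ^ 2 * a ^ 4 - a ^ 6) /
        ((2 * M) ^ 2 + a ^ 2) ^ 6 := by
  have hr : Kerr.radius a (axPoint M) = 2 * M := radius_axPoint hM.le a
  have hrpos : 0 < Kerr.radius a (axPoint M) := by rw [hr]; positivity
  rw [hQ M a (axPoint M) hrpos, hr, axPoint_three]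
  have h1 : a * (2 * M / (2 * M)) = a := by rw [div_self (by positivity), mul_one]
  rw [h1, re_add_mul_I_pow_six]

/-- **The axial sextic.** `Re[(1 + iu)⁶] = f(u²)` with `f(s) = 1 − 15s + 15s² − s³`; `f` changes sign at
`u = tan 15° ≈ 0.268` and is DECREASING on `[0, 1/4]` (`f(t) − f(s) = (t − s)(−15 + 15(t + s) − (t² + ts + s²))`).
[folklore] -/
def axialSextic (s : ℝ) : ℝ := 1 - 15 * s + 15 * s ^ 2 - s ^ 3

/-- Unfolding lemma for `axialSextic`. [folklore] -/
theorem axialSextic_apply (s : ℝ) : axialSextic s = 1 - 15 * s + 15 * s ^ 2 - s ^ 3 := rfl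

/-- The axial sextic is decreasing on `[0, 1/4]`. [folklore] -/
theorem axialSextic_antitoneOn {s t : ℝ} (hs : 0 ≤ s) (hst : s ≤ t) (ht : t ≤ 1 / 4) :
    axialSextic t ≤ axialSextic s := by
  rw [axialSextic_apply, axialSextic_apply]
  have hfac : (1 - 15 * t + 15 * t ^ 2 - t ^ 3) - (1 - 15 * s + 15 * s ^ 2 - s ^ 3) =
      (t - s) * (-15 + 15 * (t + s) - (t ^ 2 + t * s + s ^ 2)) := by ring
  have hbr : -15 + 15 * (t + s) - (t ^ 2 + t * s + s ^ 2) ≤ 0 := by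
    have hts : 0 ≤ t * s := mul_nonneg (hs.trans hst) hs
    nlinarith [sq_nonneg t, sq_nonneg s]
  have h := mul_nonpos_of_nonneg_of_nonpos (sub_nonneg.2 hst) hbr
  linarith [hfac]

/-- **Rapid rotation makes the axial numerator as negative as the sextic allows**: for `|a| ≤ M` and
`|a| ≥ χM`, `0 ≤ χ`: `Re[(2M + ia)⁶] = (2M)⁶ f(a²/(2M)²) ≤ (2M)⁶ f((χ/2)²)` (monotonicity of `f` on
`[(χ/2)², 1/4]`). [folklore] -/
theorem re_pow_six_axial_le {M a χ : ℝ} (hM : 0 < M) (ha : |a| ≤ M) (hχ : 0 ≤ χ) (haχ : χ * M ≤ |a|) :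
    (2 * M) ^ 6 - 15 * (2 * M) ^ 4 * a ^ 2 + 15 * (2 * M) ^ 2 * a ^ 4 - a ^ 6 ≤
      (2 * M) ^ 6 * axialSextic ((χ / 2) ^ 2) := by
  have hM2 : 0 < (2 * M) ^ 2 := by positivity
  set s : ℝ := a ^ 2 / (2 * M) ^ 2 with hsdef
  have hnum : (2 * M) ^ 6 - 15 * (2 * M) ^ 4 * a ^ 2 + 15 * (2 * M) ^ 2 * a ^ 4 - a ^ 6 =
      (2 * M) ^ 6 * axialSextic s := by
    rw [axialSextic_apply, hsdef]
    field_simp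
  rw [hnum]
  refine mul_le_mul_of_nonneg_left (axialSextic_antitoneOn (by positivity) ?_ ?_) (by positivity)
  · -- `(χ/2)² ≤ a²/(2M)²`
    rw [hsdef, le_div_iff₀ hM2]
    have h := pow_le_pow_left₀ (by positivity) haχ 2
    rw [sq_abs] at h
    nlinarith [h]
  · -- `a²/(2M)² ≤ 1/4`
    rw [hsdef, div_le_iff₀ hM2]
    have h := pow_le_pow_left₀ (abs_nonneg a) ha 2
    rw [sq_abs] at h
    nlinarith [h]

/-- **The axial Kretschmann scalar of rapidly rotating Kerr is quantitatively negative**: for `|a| ≤ M`,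
`|a| ≥ χM` with `f((χ/2)²) ≤ 0` (i.e. `χ ≥ 2 tan 15° ≈ 0.536`), `|Rm|²(y_ax) ≤ (3072/15625) f((χ/2)²) M⁻⁴`
(numerator `≤ (2M)⁶ f`, denominator `≤ (5M²)⁶`). [cite: arXiv07060622, §3] -/
theorem kretschmann_axPoint_le
    (hQ : Kerr.kretschmannScalar_closedForm)
    {M a χ : ℝ} (hM : 0 < M) (ha : |a| ≤ M) (hχ : 0 ≤ χ) (haχ : χ * M ≤ |a|)
    (hf : axialSextic ((χ / 2) ^ 2) ≤ 0) :
    rmNormSqAt (Kerr.bilin M a) (axPoint M) ≤ 3072 / 15625 * axialSextic ((χ / 2) ^ 2) * (M ^ 4)⁻¹ := by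
  rw [kretschmann_axPoint hQ hM a]
  set fχ := axialSextic ((χ / 2) ^ 2) with hfχ
  have hN := re_pow_six_axial_le hM ha hχ haχ
  have h2 : a ^ 2 ≤ M ^ 2 := by
    have h := pow_le_pow_left₀ (abs_nonneg a) ha 2
    rwa [sq_abs] at h
  have hD : ((2 * M) ^ 2 + a ^ 2) ^ 6 ≤ (5 * M ^ 2) ^ 6 :=
    pow_le_pow_left₀ (by positivity) (by nlinarith) 6
  have hDpos : 0 < ((2 * M) ^ 2 + a ^ 2) ^ 6 := by positivity
  have hnum : 48 * M ^ 2 * ((2 * M) ^ 6 - 15 * (2 * M) ^ 4 * a ^ 2 + 15 * (2 * M) ^ 2 * a ^ 4 - a ^ 6) ≤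
      48 * M ^ 2 * ((2 * M) ^ 6 * fχ) := mul_le_mul_of_nonneg_left hN (by positivity)
  have hneg : 48 * M ^ 2 * ((2 * M) ^ 6 * fχ) ≤ 0 := by
    have : 0 ≤ 48 * M ^ 2 * (2 * M) ^ 6 := by positivity
    nlinarith
  calc 48 * M ^ 2 * ((2 * M) ^ 6 - 15 * (2 * M) ^ 4 * a ^ 2 + 15 * (2 * M) ^ 2 * a ^ 4 - a ^ 6) /
        ((2 * M) ^ 2 + a ^ 2) ^ 6
      ≤ 48 * M ^ 2 * ((2 * M) ^ 6 * fχ) / ((2 * M) ^ 2 + a ^ 2) ^ 6 := div_le_div_of_nonneg_right hnum hDpos.le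
    _ ≤ 48 * M ^ 2 * ((2 * M) ^ 6 * fχ) / (5 * M ^ 2) ^ 6 := by
        rw [div_eq_mul_inv, div_eq_mul_inv]
        exact mul_le_mul_of_nonpos_left (inv_anti₀ hDpos hD) hneg
    _ = 3072 / 15625 * fχ * (M ^ 4)⁻¹ := by field_simp; ring

set_option maxHeartbeats 800000 in
/-- **SPIN BOUND: quiet RAPIDLY rotating collars need negative curvature at the pole.** Given the closed
form of the Kretschmann scalar of Kerr (named fact, hypothesis `hQ`), a ratio `0 < χ ≤ 1` beyond the sign
change of the axial sextic (`f((χ/2)²) < 0`, i.e. `χ > 2 tan 15° ≈ 0.536`; e.g. `χ = 3/5`), a label window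
`m₀ > 0` and a boost bound `ρ₀`, there is `δ₀ > 0` such that every thick Kerr collar chart of ANY spacetime `𝓢`
(windowed label, bounded boost, smooth on the collar layer) which is `δ₀`-quiet in `C²` on the thick slab and
whose image of the AXIAL slab point `x_ax = Λ(0, 0, 0, 2M₁) + c` has Kretschmann scalar
`≥ (1536/15625) f((χ/2)²) m₀⁴` (a negative threshold; e.g. `≥ 0`) has label ratio `|a₁|/M₁ < χ`: by curvature
tracking the host value is within `Aδ₀ < −(1536/15625) f m₀⁴` of the Kerr value at `y_ax`, which for
`|a₁| ≥ χM₁` is `≤ (3072/15625) f M₁⁻⁴ ≤ (3072/15625) f m₀⁴` (`kretschmann_axPoint_le`). This is the first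
NON-VACUOUS instance of the collar-margin mechanism of crux `GenericCensorshipCollarMargin`
(stmt-FinalStateConjecture-10809): a margin `χ₁ = χ < 1` forced by the sign of the host's curvature (negative
Kretschmann — gravitomagnetic dominance — occurs only near the poles of rapidly rotating holes).
[cite: arXiv07060622, §3] -/
theorem abs_spin_lt_of_kretschmannAt_axial_ge
    (hQ : Kerr.kretschmannScalar_closedForm)
    {χ : ℝ} (hχ0 : 0 < χ) (hf : axialSextic ((χ / 2) ^ 2) < 0)
    {m₀ : ℝ} (hm₀ : 0 < m₀) (ρ₀ : ℝ) :
    ∃ δ₀ : ℝ, 0 < δ₀ ∧ ∀ (𝓢 : Spacetime 4) (M₁ a₁ : ℝ) (Λ : lorentzGroup) (c : E4)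
      (B : ModelBackground) (Φ₁ : B.domain → 𝓢.carrier),
      m₀ ≤ M₁ → M₁ ≤ m₀⁻¹ → |a₁| ≤ M₁ →
      ‖((Λ : E4 ≃L[ℝ] E4) : E4 →L[ℝ] E4)‖ ≤ ρ₀ → ‖((Λ : E4 ≃L[ℝ] E4).symm : E4 →L[ℝ] E4)‖ ≤ ρ₀ →
      B = starBackground Λ c M₁ a₁ (fun x ↦ Kerr.radius a₁ (poincareInv Λ c x)) →
      ContMDiffOn 𝓘(ℝ, E4) (𝓡 4) ∞ Φ₁
        {x | -1 < B.time x.1 ∧ B.time x.1 < 1 ∧ B.radius x.1 < 3 * M₁ + 1} →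
      𝓢.truncDeviationCk B Φ₁ 2 (3 * M₁) 0 ≤ ENNReal.ofReal δ₀ →
      (∀ x : B.domain, (x : E4) = (Λ : E4 ≃L[ℝ] E4) (axPoint M₁) + c →
        1536 / 15625 * axialSextic ((χ / 2) ^ 2) * m₀ ^ 4 ≤ 𝓢.kretschmannAt (Φ₁ x)) →
      |a₁| < χ * M₁ := by
  obtain ⟨δ₁, A, hδ₁, hA0, H⟩ := abs_kretschmannAt_sub_rmNormSqAt_le isSlabPointMap_axPoint hm₀ ρ₀
  set fχ := axialSextic ((χ / 2) ^ 2) with hfχ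
  set κ : ℝ := -(1536 / 15625 * fχ * m₀ ^ 4) with hκ
  have hκpos : 0 < κ := by
    have : 0 < -fχ := neg_pos.2 hf
    have hm4 : 0 < m₀ ^ 4 := by positivity
    rw [hκ]; nlinarith
  set δ₀ : ℝ := min δ₁ (κ / (A + 1)) with hδ₀
  have hδ₀pos : 0 < δ₀ := lt_min hδ₁ (by positivity)
  have hδ₀δ₁ : δ₀ ≤ δ₁ := min_le_left _ _
  have hδ₀A : δ₀ ≤ κ / (A + 1) := min_le_right _ _
  refine ⟨δ₀, hδ₀pos, fun 𝓢 M₁ a₁ Λ c B Φ₁ hlo hhi ha hΛ hΛ' hB hΦ hle hKr ↦ ?_⟩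
  by_contra hnot
  have ha' : χ * M₁ ≤ |a₁| := not_lt.1 hnot
  have hM : 0 < M₁ := hm₀.trans_le hlo
  -- the axial point is a point of the domain
  have hdomF : (B.domain : Set E4) = poincareInv Λ c ⁻¹' (Kerr.region a₁ M₁ : Set E4) := by rw [hB]; rfl
  set xe : E4 := (Λ : E4 ≃L[ℝ] E4) (axPoint M₁) + c with hxe
  have hP : poincareInv Λ c xe = axPoint M₁ := by
    show (Λ : E4 ≃L[ℝ] E4).symm (xe - c) = axPoint M₁
    rw [hxe, add_sub_cancel_right, ContinuousLinearEquiv.symm_apply_apply]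
  have hxe_dom : xe ∈ (B.domain : Set E4) := by
    rw [hdomF]; show poincareInv Λ c xe ∈ (Kerr.region a₁ M₁ : Set E4); rw [hP]
    exact mem_region_of_isSlabPointMap isSlabPointMap_axPoint hm₀ (mem_paramSet_of Λ hlo hhi ha hΛ hΛ')
  have htrack := H 𝓢 M₁ a₁ Λ c B Φ₁ δ₀ hlo hhi ha hΛ hΛ' hB hΦ hδ₀pos.le hδ₀δ₁ hle ⟨xe, hxe_dom⟩ rfl
  have hKx := hKr ⟨xe, hxe_dom⟩ rfl
  have hmodel : rmNormSqAt (Kerr.bilin M₁ a₁) (axPoint M₁) ≤ 3072 / 15625 * fχ * (M₁ ^ 4)⁻¹ :=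
    kretschmann_axPoint_le hQ hM ha hχ0.le ha' hf.le
  have hm4 : m₀ ^ 4 ≤ (M₁ ^ 4)⁻¹ := by
    have h : M₁ ^ 4 ≤ (m₀ ^ 4)⁻¹ := by
      rw [← inv_pow]; exact pow_le_pow_left₀ hM.le hhi 4
    rw [le_inv_comm₀ (by positivity) (by positivity)]; exact h
  have hmodel' : rmNormSqAt (Kerr.bilin M₁ a₁) (axPoint M₁) ≤ 3072 / 15625 * fχ * m₀ ^ 4 := by
    have h : 3072 / 15625 * fχ * (M₁ ^ 4)⁻¹ ≤ 3072 / 15625 * fχ * m₀ ^ 4 :=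
      mul_le_mul_of_nonpos_left hm4 (by nlinarith)
    exact hmodel.trans h
  have hδA : A * δ₀ < κ := by
    have h2 : A * δ₀ ≤ A * (κ / (A + 1)) := mul_le_mul_of_nonneg_left hδ₀A hA0
    have h3 : A * (κ / (A + 1)) < κ := by
      rw [mul_div_assoc', div_lt_iff₀ (by positivity)]
      nlinarith
    linarith
  have h1 : 𝓢.kretschmannAt (Φ₁ ⟨xe, hxe_dom⟩) - rmNormSqAt (Kerr.bilin M₁ a₁) (axPoint M₁) ≤ A * δ₀ :=
    (abs_sub_le_iff.1 htrack).1
  rw [hκ] at hδA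
  linarith

/-- **Clause form of the spin bound**: hosts whose Kretschmann scalar is NONNEGATIVE on the image of the
thick slab satisfy the windowed, bounded-boost collar-margin clause NON-VACUOUSLY with every `χ₁ = χ` beyond
the sign change of the axial sextic (`f((χ/2)²) < 0`, e.g. `χ = 3/5`) at order `k₁ = 2`.
[cite: arXiv07060622, §3] -/
theorem abs_spin_le_of_kretschmannAt_nonneg_on_slab
    (hQ : Kerr.kretschmannScalar_closedForm)
    {χ : ℝ} (hχ0 : 0 < χ) (hf : axialSextic ((χ / 2) ^ 2) < 0)
    {m₀ : ℝ} (hm₀ : 0 < m₀) (ρ₀ : ℝ) :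
    ∃ δ₀ : ℝ, 0 < δ₀ ∧ ∀ (𝓢 : Spacetime 4) (M₁ a₁ : ℝ) (Λ : lorentzGroup) (c : E4)
      (B : ModelBackground) (Φ₁ : B.domain → 𝓢.carrier),
      m₀ ≤ M₁ → M₁ ≤ m₀⁻¹ → |a₁| ≤ M₁ →
      ‖((Λ : E4 ≃L[ℝ] E4) : E4 →L[ℝ] E4)‖ ≤ ρ₀ → ‖((Λ : E4 ≃L[ℝ] E4).symm : E4 →L[ℝ] E4)‖ ≤ ρ₀ →
      B = starBackground Λ c M₁ a₁ (fun x ↦ Kerr.radius a₁ (poincareInv Λ c x)) →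
      ContMDiffOn 𝓘(ℝ, E4) (𝓡 4) ∞ Φ₁
        {x | -1 < B.time x.1 ∧ B.time x.1 < 1 ∧ B.radius x.1 < 3 * M₁ + 1} →
      𝓢.truncDeviationCk B Φ₁ 2 (3 * M₁) 0 ≤ ENNReal.ofReal δ₀ →
      (∀ x ∈ B.truncTimeSlab (3 * M₁) 0, 0 ≤ 𝓢.kretschmannAt (Φ₁ x)) →
      |a₁| ≤ χ * M₁ := by
  obtain ⟨δ₀, hδ₀, H⟩ := abs_spin_lt_of_kretschmannAt_axial_ge hQ hχ0 hf hm₀ ρ₀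
  refine ⟨δ₀, hδ₀, fun 𝓢 M₁ a₁ Λ c B Φ₁ hlo hhi ha hΛ hΛ' hB hΦ hle hK ↦
    (H 𝓢 M₁ a₁ Λ c B Φ₁ hlo hhi ha hΛ hΛ' hB hΦ hle fun x hx ↦ ?_).le⟩
  -- the axial point lies on the thick slab `{t* = 0, r ≤ 3M₁}`
  have hM : 0 < M₁ := hm₀.trans_le hlo
  have hP : poincareInv Λ c x = axPoint M₁ := by
    show (Λ : E4 ≃L[ℝ] E4).symm ((x : E4) - c) = axPoint M₁
    rw [hx, add_sub_cancel_right, ContinuousLinearEquiv.symm_apply_apply]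
  have htimeF : B.time = fun x ↦ poincareInv Λ c x 0 := by rw [hB]; rfl
  have hradF : B.radius = fun x ↦ Kerr.radius a₁ (poincareInv Λ c x) := by rw [hB]; rfl
  have hslab : x ∈ B.truncTimeSlab (3 * M₁) 0 := by
    refine ⟨?_, ?_⟩
    · show B.time x = 0
      rw [htimeF]; show (poincareInv Λ c x) 0 = 0; rw [hP]; exact axPoint_zero M₁
    · show B.radius x ≤ 3 * M₁
      rw [hradF]; show Kerr.radius a₁ (poincareInv Λ c x) ≤ 3 * M₁
      rw [hP, radius_axPoint hM.le]; linarith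
  have h0 := hK x hslab
  have hneg : 1536 / 15625 * axialSextic ((χ / 2) ^ 2) * m₀ ^ 4 ≤ 0 := by
    have : 0 ≤ m₀ ^ 4 := by positivity
    nlinarith
  linarith

/-- The axial sextic is negative at `χ = 3/5`: `f(9/100) = −0.2292… < 0`. [folklore] -/
theorem axialSextic_three_fifths_neg : axialSextic (((3 : ℝ) / 5 / 2) ^ 2) < 0 := by
  rw [axialSextic_apply]; norm_num

end Axial

end KerrWindow

/-! ## Part I: slowly rotating Kerr spacetimes satisfy the windowed collar-margin clause NON-VACUOUSLY -/

/-- `Re (r + ib)⁶ ≥ 0` for `b² ≤ r²/16` (`r⁶ − 15r⁴b² + 15r²b⁴ − b⁶ ≥ r⁶/16 − r⁶/4096`). [folklore] -/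
theorem Kerr.re_pow_six_nonneg_of_sq_le {r b : ℝ} (h : b ^ 2 ≤ r ^ 2 / 16) :
    0 ≤ r ^ 6 - 15 * r ^ 4 * b ^ 2 + 15 * r ^ 2 * b ^ 4 - b ^ 6 := by
  have hb0 : 0 ≤ b ^ 2 := sq_nonneg b
  have hr0 : 0 ≤ r ^ 2 := sq_nonneg r
  have h3 : (b ^ 2) ^ 3 ≤ (r ^ 2 / 16) ^ 3 := pow_le_pow_left₀ hb0 h 3
  have h4 : 0 ≤ 15 * r ^ 2 * b ^ 4 := by positivity
  have h5 : 15 * r ^ 4 * b ^ 2 ≤ 15 * r ^ 4 * (r ^ 2 / 16) :=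
    mul_le_mul_of_nonneg_left h (by positivity)
  nlinarith [h3, h4, h5, pow_nonneg hr0 3]

/-- **Away from the hole, Kerr has nonnegative Kretschmann scalar**: at every point of `Kerr.spacetime M a r₀`
with Kerr–Schild radius `r ≥ 4|a|` (so `|a cos θ| ≤ |a| ≤ r/4 < r tan 15°`), `48M² Re[(r + ia cos θ)⁶]/(r² + a²cos²θ)⁶ ≥ 0`
(given the closed form, hypothesis `hQ`). Negative Kretschmann — the signature of rapid rotation read at the axial
image point of a quiet collar — only occurs within `4|a| ≤ 4M` of the centre, near the poles. [cite: arXiv07060622, §3] -/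
theorem Kerr.kretschmannAt_spacetime_nonneg_of_le_radius [Kerr.Facts]
    (hQ : Kerr.kretschmannScalar_closedForm)
    {M a r₀ : ℝ} (hM : 0 ≤ M) (x : (Kerr.spacetime M a r₀ hM).carrier) (hxa : 4 * |a| ≤ Kerr.radius a x.1) :
    0 ≤ (Kerr.spacetime M a r₀ hM).kretschmannAt x := by
  rw [Kerr.kretschmannAt_spacetime hQ M a r₀ hM x, KerrWindow.re_add_mul_I_pow_six]
  have hx : max r₀ 0 < Kerr.radius a x.1 := Kerr.mem_region.1 x.2
  have hr : 0 < Kerr.radius a x.1 := lt_of_le_of_lt (le_max_right _ _) hx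
  set r := Kerr.radius a x.1 with hrdef
  set b := a * (x.1 3 / r) with hbdef
  have hz : x.1 3 ^ 2 ≤ r ^ 2 := Kerr.sq_apply_three_le_radius_sq a hr
  have hcos : (x.1 3 / r) ^ 2 ≤ 1 := by
    rw [div_pow, div_le_one (by positivity)]; exact hz
  have ha2 : a ^ 2 ≤ r ^ 2 / 16 := by
    have h := pow_le_pow_left₀ (by positivity) hxa 2
    rw [mul_pow, sq_abs] at h
    linarith
  have hb : b ^ 2 ≤ r ^ 2 / 16 := by
    rw [hbdef, mul_pow]
    calc a ^ 2 * (x.1 3 / r) ^ 2 ≤ r ^ 2 / 16 * 1 :=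
          mul_le_mul ha2 hcos (sq_nonneg _) (by positivity)
      _ = r ^ 2 / 16 := by ring
  have hnum := Kerr.re_pow_six_nonneg_of_sq_le hb
  have hden : 0 < (r ^ 2 + b ^ 2) ^ 6 := by positivity
  exact div_nonneg (mul_nonneg (by positivity) hnum) hden.le

/-- **Slowly rotating Kerr has nonnegative Kretschmann scalar everywhere.** On `Kerr.spacetime M a r₀` with
`0 < M`, `|a| ≤ M/4` and `M ≤ r₀` every point has `r > r₀ ≥ M ≥ 4|a|`. [cite: arXiv07060622, §3] -/
theorem Kerr.kretschmannAt_spacetime_nonneg [Kerr.Facts]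
    (hQ : Kerr.kretschmannScalar_closedForm)
    {M a r₀ : ℝ} (hM : 0 < M) (ha : |a| ≤ M / 4) (hr₀ : M ≤ r₀)
    (x : (Kerr.spacetime M a r₀ hM.le).carrier) :
    0 ≤ (Kerr.spacetime M a r₀ hM.le).kretschmannAt x := by
  refine Kerr.kretschmannAt_spacetime_nonneg_of_le_radius hQ hM.le x ?_
  have hx : max r₀ 0 < Kerr.radius a x.1 := Kerr.mem_region.1 x.2
  have hrM : M < Kerr.radius a x.1 := lt_of_le_of_lt (hr₀.trans (le_max_left _ _)) hx
  linarith

/-- **CENSUS IN A KERR HOST: rapidly-labelled quiet collars hug the hole.** In ANY Kerr spacetime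
`Kerr.spacetime M a r₀` (given `hQ`), for every ratio `χ` beyond the sign change of the axial sextic
(`axialSextic ((χ/2)²) < 0`, e.g. `χ = 3/5`), label window `m₀` and boost bound `ρ₀` there is `δ₀ > 0` such that
every `δ₀`-quiet windowed, bounded-boost thick Kerr collar chart of label ratio `|a₁| ≥ χ M₁` maps its axial slab
point to a host point of Kerr–Schild radius `< 4|a|` (`≤ 4M`): elsewhere the host's Kretschmann scalar is `≥ 0`
(`kretschmannAt_spacetime_nonneg_of_le_radius`) and the spin bound would force `|a₁| < χ M₁`. [cite: arXiv07060622, §3] -/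
theorem Kerr.radius_axialImage_lt_of_quietCollar [Kerr.Facts]
    (hQ : Kerr.kretschmannScalar_closedForm)
    {M a r₀ : ℝ} (hM : 0 ≤ M) {χ : ℝ} (hχ0 : 0 < χ) (hf : KerrWindow.axialSextic ((χ / 2) ^ 2) < 0)
    {m₀ : ℝ} (hm₀ : 0 < m₀) (ρ₀ : ℝ) :
    ∃ δ₀ : ℝ, 0 < δ₀ ∧ ∀ (M₁ a₁ : ℝ) (Λ : lorentzGroup) (c : E4) (B : ModelBackground)
      (Φ₁ : B.domain → (Kerr.spacetime M a r₀ hM).carrier),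
      m₀ ≤ M₁ → M₁ ≤ m₀⁻¹ → |a₁| ≤ M₁ →
      ‖((Λ : E4 ≃L[ℝ] E4) : E4 →L[ℝ] E4)‖ ≤ ρ₀ → ‖((Λ : E4 ≃L[ℝ] E4).symm : E4 →L[ℝ] E4)‖ ≤ ρ₀ →
      B = starBackground Λ c M₁ a₁ (fun x ↦ Kerr.radius a₁ (poincareInv Λ c x)) →
      ContMDiffOn 𝓘(ℝ, E4) (𝓡 4) ∞ Φ₁
        {x | -1 < B.time x.1 ∧ B.time x.1 < 1 ∧ B.radius x.1 < 3 * M₁ + 1} →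
      (Kerr.spacetime M a r₀ hM).truncDeviationCk B Φ₁ 2 (3 * M₁) 0 ≤ ENNReal.ofReal δ₀ →
      χ * M₁ ≤ |a₁| →
      ∀ x : B.domain, (x : E4) = (Λ : E4 ≃L[ℝ] E4) (KerrWindow.axPoint M₁) + c →
        Kerr.radius a (Φ₁ x).1 < 4 * |a| := by
  obtain ⟨δ₀, hδ₀, H⟩ := KerrWindow.abs_spin_lt_of_kretschmannAt_axial_ge hQ hχ0 hf hm₀ ρ₀
  refine ⟨δ₀, hδ₀, fun M₁ a₁ Λ c B Φ₁ hlo hhi ha₁ hΛ hΛ' hB hΦ hle hχa x hx ↦ ?_⟩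
  by_contra hge
  have hge' : 4 * |a| ≤ Kerr.radius a (Φ₁ x).1 := not_lt.1 hge
  have hlt := H _ M₁ a₁ Λ c B Φ₁ hlo hhi ha₁ hΛ hΛ' hB hΦ hle fun x' hx' ↦ by
    have hxx : x' = x := Subtype.ext (hx'.trans hx.symm)
    rw [hxx]
    have h0 := Kerr.kretschmannAt_spacetime_nonneg_of_le_radius hQ hM (Φ₁ x) hge'
    have hthr : 1536 / 15625 * KerrWindow.axialSextic ((χ / 2) ^ 2) * m₀ ^ 4 ≤ 0 := by
      have : 0 ≤ m₀ ^ 4 := by positivity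
      nlinarith
    exact hthr.trans h0
  linarith

/-- **SLOWLY ROTATING KERR SPACETIMES SATISFY THE WINDOWED, BOUNDED-BOOST COLLAR-MARGIN CLAUSE
NON-VACUOUSLY, with `χ₁ = 3/5` at order `k₁ = 2`.** On `Kerr.spacetime M a r₀` (`0 < M`, `|a| ≤ M/4`,
`M ≤ r₀`; horizon-penetrating for `r₀ < r₊`), for every label window `m₀ > 0` and boost bound `ρ₀` there is
`δ₀ > 0` such that EVERY thick Kerr collar chart into it with windowed label, bounded boost, smooth on the
collar layer and `δ₀`-quiet in `C²` on its thick slab has label ratio `|a₁|/M₁ ≤ 3/5` (spin bound +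
nonnegativity of the host's Kretschmann scalar). For `r₀ = M` the identity chart of the host is such a collar
(label `(M, a)`, ratio `|a|/M ≤ 1/4`, deviation `0`), so the clause is witnessed NON-vacuously: the first black-hole instance of the collar-margin
mechanism of crux `GenericCensorshipCollarMargin` (stmt-FinalStateConjecture-10809), conditional on the named
fact `Kerr.kretschmannScalar_closedForm` and the chart facts `[Kerr.Facts]`. [cite: arXiv07060622, §3] -/
theorem Kerr.abs_spin_le_of_quietCollar_spacetime_slow [Kerr.Facts]
    (hQ : Kerr.kretschmannScalar_closedForm)
    {M a r₀ : ℝ} (hM : 0 < M) (ha : |a| ≤ M / 4) (hr₀ : M ≤ r₀) {m₀ : ℝ} (hm₀ : 0 < m₀) (ρ₀ : ℝ) :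
    ∃ δ₀ : ℝ, 0 < δ₀ ∧ ∀ (M₁ a₁ : ℝ) (Λ : lorentzGroup) (c : E4) (B : ModelBackground)
      (Φ₁ : B.domain → (Kerr.spacetime M a r₀ hM.le).carrier),
      m₀ ≤ M₁ → M₁ ≤ m₀⁻¹ → |a₁| ≤ M₁ →
      ‖((Λ : E4 ≃L[ℝ] E4) : E4 →L[ℝ] E4)‖ ≤ ρ₀ → ‖((Λ : E4 ≃L[ℝ] E4).symm : E4 →L[ℝ] E4)‖ ≤ ρ₀ →
      B = starBackground Λ c M₁ a₁ (fun x ↦ Kerr.radius a₁ (poincareInv Λ c x)) →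
      ContMDiffOn 𝓘(ℝ, E4) (𝓡 4) ∞ Φ₁
        {x | -1 < B.time x.1 ∧ B.time x.1 < 1 ∧ B.radius x.1 < 3 * M₁ + 1} →
      (Kerr.spacetime M a r₀ hM.le).truncDeviationCk B Φ₁ 2 (3 * M₁) 0 ≤ ENNReal.ofReal δ₀ →
      |a₁| ≤ 3 / 5 * M₁ := by
  obtain ⟨δ₀, hδ₀, H⟩ := KerrWindow.abs_spin_le_of_kretschmannAt_nonneg_on_slab hQ
    (χ := 3 / 5) (by norm_num) KerrWindow.axialSextic_three_fifths_neg hm₀ ρ₀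
  exact ⟨δ₀, hδ₀, fun M₁ a₁ Λ c B Φ₁ hlo hhi ha₁ hΛ hΛ' hB hΦ hle ↦
    H _ M₁ a₁ Λ c B Φ₁ hlo hhi ha₁ hΛ hΛ' hB hΦ hle fun x _ ↦
      Kerr.kretschmannAt_spacetime_nonneg hQ hM ha hr₀ (Φ₁ x)⟩


/-- **Clause form of the black-hole certificate**: a slowly rotating Kerr spacetime `Kerr.spacetime M a r₀`
(`0 < M`, `|a| ≤ M/4`, `M ≤ r₀`) satisfies the windowed, bounded-boost collar-margin clause of the restated crux
C‴ (`Cruxes/GenericCensorshipCollarMargin/RestatementProbeC3.lean`, body with `boostNorm = max ‖Λ‖ ‖Λ⁻¹‖`) with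
`χ₁ = 3/5 < 1`, `k₁ = 2`, `K₁ = ∅`, NON-VACUOUSLY (for `r₀ = M` the identity chart is a windowed quiet collar of
ratio `≤ 1/4`): every thick Kerr collar chart into it with windowed label, bounded boost, smooth on the collar
layer and `δ₁`-quiet in `C²` on its slab has `|a₁| ≤ (3/5) M₁` (the open-embedding and `Disjoint` hypotheses are
not needed). [cite: arXiv07060622, §3] -/
theorem Kerr.windowedCollarMargin_spacetime_slow [Kerr.Facts]
    (hQ : Kerr.kretschmannScalar_closedForm)
    {M a r₀ : ℝ} (hM : 0 < M) (ha : |a| ≤ M / 4) (hr₀ : M ≤ r₀) {m₀ : ℝ} (hm₀ : 0 < m₀) (ρ₀ : ℝ) :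
    ∃ (χ₁ : ℝ) (k₁ : ℕ) (δ₁ : ENNReal) (K₁ : Set (Kerr.spacetime M a r₀ hM.le).carrier), χ₁ < 1 ∧ 0 < δ₁ ∧
      IsCompact K₁ ∧
      ∀ (M₁ a₁ : ℝ) (mo₁ : lorentzGroup × E4) (B₁ : ModelBackground)
        (Φ₁ : B₁.domain → (Kerr.spacetime M a r₀ hM.le).carrier),
        m₀ ≤ M₁ → M₁ ≤ m₀⁻¹ →
        max ‖((mo₁.1 : E4 ≃L[ℝ] E4) : E4 →L[ℝ] E4)‖ ‖((mo₁.1 : E4 ≃L[ℝ] E4).symm : E4 →L[ℝ] E4)‖ ≤ ρ₀ →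
        |a₁| ≤ M₁ →
        B₁ = starBackground mo₁.1 mo₁.2 M₁ a₁ (fun x => Kerr.radius a₁ (poincareInv mo₁.1 mo₁.2 x)) →
        ContMDiffOn 𝓘(ℝ, E4) (𝓡 4) ((⊤ : ℕ∞) : WithTop ℕ∞) Φ₁
          {x | -1 < B₁.time x.1 ∧ B₁.time x.1 < 1 ∧ B₁.radius x.1 < 3 * M₁ + 1} →
        Topology.IsOpenEmbedding
          ({x | -1 < B₁.time x.1 ∧ B₁.time x.1 < 1 ∧ B₁.radius x.1 < 3 * M₁ + 1}.restrict Φ₁) →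
        (Kerr.spacetime M a r₀ hM.le).truncDeviationCk B₁ Φ₁ k₁ (3 * M₁) 0 ≤ δ₁ →
        Disjoint (Φ₁ '' B₁.truncTimeSlab (3 * M₁) 0)
          ((Kerr.spacetime M a r₀ hM.le).metric.causalPast
            (Kerr.spacetime M a r₀ hM.le).timeOrientation K₁) →
        |a₁| ≤ χ₁ * M₁ := by
  obtain ⟨δ₀, hδ₀, H⟩ := Kerr.abs_spin_le_of_quietCollar_spacetime_slow hQ hM ha hr₀ hm₀ ρ₀
  refine ⟨3 / 5, 2, ENNReal.ofReal δ₀, ∅, by norm_num, ENNReal.ofReal_pos.2 hδ₀, isCompact_empty, ?_⟩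
  intro M₁ a₁ mo₁ B₁ Φ₁ hlo hhi hmo ha₁ hB hΦ _ hdev _
  exact H M₁ a₁ mo₁.1 mo₁.2 B₁ Φ₁ hlo hhi ha₁ ((le_max_left _ _).trans hmo) ((le_max_right _ _).trans hmo)
    hB hΦ hdev


/-- `|Re (r + ib)⁶| ≤ 4 (r² + b²)³` (`4(r² + b²)³ − (r⁶ + 15r⁴b² + 15r²b⁴ + b⁶) = 3(r² − b²)²(r² + b²) ≥ 0`).
[folklore] -/
theorem Kerr.abs_re_pow_six_le (r b : ℝ) :
    |r ^ 6 - 15 * r ^ 4 * b ^ 2 + 15 * r ^ 2 * b ^ 4 - b ^ 6| ≤ 4 * (r ^ 2 + b ^ 2) ^ 3 := by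
  have hkey : 4 * (r ^ 2 + b ^ 2) ^ 3 - (r ^ 6 + 15 * r ^ 4 * b ^ 2 + 15 * r ^ 2 * b ^ 4 + b ^ 6) =
      3 * ((r ^ 2 - b ^ 2) ^ 2 * (r ^ 2 + b ^ 2)) := by ring
  have hnn : 0 ≤ 3 * ((r ^ 2 - b ^ 2) ^ 2 * (r ^ 2 + b ^ 2)) := by positivity
  rw [abs_le]
  constructor
  · nlinarith [sq_nonneg r, sq_nonneg b, pow_nonneg (sq_nonneg r) 3, pow_nonneg (sq_nonneg b) 3,
      mul_nonneg (pow_nonneg (sq_nonneg r) 2) (sq_nonneg b), mul_nonneg (sq_nonneg r) (pow_nonneg (sq_nonneg b) 2)]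
  · nlinarith [sq_nonneg r, sq_nonneg b, pow_nonneg (sq_nonneg r) 3, pow_nonneg (sq_nonneg b) 3,
      mul_nonneg (pow_nonneg (sq_nonneg r) 2) (sq_nonneg b), mul_nonneg (sq_nonneg r) (pow_nonneg (sq_nonneg b) 2)]

/-- **The Kretschmann scalar of a Kerr spacetime is bounded by `192 M²/r⁶`** at every point of the chart
(`|48M² Re[(r + ib)⁶]/(r² + b²)⁶| ≤ 192M²/(r² + b²)³ ≤ 192M²/r⁶`, `b = a cos θ`; given `hQ`).
[cite: arXiv07060622, §3] -/
theorem Kerr.abs_kretschmannAt_spacetime_le [Kerr.Facts]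
    (hQ : Kerr.kretschmannScalar_closedForm)
    {M a r₀ : ℝ} (hM : 0 ≤ M) (x : (Kerr.spacetime M a r₀ hM).carrier) :
    |(Kerr.spacetime M a r₀ hM).kretschmannAt x| ≤ 192 * M ^ 2 / Kerr.radius a x.1 ^ 6 := by
  rw [Kerr.kretschmannAt_spacetime hQ M a r₀ hM x, KerrWindow.re_add_mul_I_pow_six]
  have hx : max r₀ 0 < Kerr.radius a x.1 := Kerr.mem_region.1 x.2
  have hr : 0 < Kerr.radius a x.1 := lt_of_le_of_lt (le_max_right _ _) hx
  set r := Kerr.radius a x.1 with hrdef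
  set b := a * (x.1 3 / r) with hbdef
  have hS : 0 < r ^ 2 + b ^ 2 := by positivity
  have hnum := Kerr.abs_re_pow_six_le r b
  rw [abs_div, abs_mul, abs_of_nonneg (by positivity : (0 : ℝ) ≤ 48 * M ^ 2),
    abs_of_pos (by positivity : (0 : ℝ) < (r ^ 2 + b ^ 2) ^ 6), div_le_div_iff₀ (by positivity) (by positivity)]
  -- `48 M² |num| r⁶ ≤ 192 M² (r² + b²)⁶`
  have h1 : 48 * M ^ 2 * |r ^ 6 - 15 * r ^ 4 * b ^ 2 + 15 * r ^ 2 * b ^ 4 - b ^ 6| * r ^ 6 ≤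
      48 * M ^ 2 * (4 * (r ^ 2 + b ^ 2) ^ 3) * r ^ 6 :=
    mul_le_mul_of_nonneg_right (mul_le_mul_of_nonneg_left hnum (by positivity)) (by positivity)
  have h2 : r ^ 6 ≤ (r ^ 2 + b ^ 2) ^ 3 := by
    have : r ^ 2 ≤ r ^ 2 + b ^ 2 := by nlinarith [sq_nonneg b]
    calc r ^ 6 = (r ^ 2) ^ 3 := by ring
      _ ≤ (r ^ 2 + b ^ 2) ^ 3 := pow_le_pow_left₀ (sq_nonneg r) this 3
  calc 48 * M ^ 2 * |r ^ 6 - 15 * r ^ 4 * b ^ 2 + 15 * r ^ 2 * b ^ 4 - b ^ 6| * r ^ 6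
      ≤ 48 * M ^ 2 * (4 * (r ^ 2 + b ^ 2) ^ 3) * r ^ 6 := h1
    _ ≤ 48 * M ^ 2 * (4 * (r ^ 2 + b ^ 2) ^ 3) * (r ^ 2 + b ^ 2) ^ 3 :=
        mul_le_mul_of_nonneg_left h2 (by positivity)
    _ = 192 * M ^ 2 * (r ^ 2 + b ^ 2) ^ 6 := by ring

/-- **MASS RIGIDITY (LOWER BOUND) IN A KERR HOST: no small quiet collars in a big hole's chart.** In
`Kerr.spacetime M a r₀` with `0 < M ≤ r₀` (so `r > M` on the carrier and `|Rm|² ≤ 192M⁻⁴`), for every label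
window `m₀` and boost bound `ρ₀` there are `δ₁ > 0`, `A ≥ 0` such that every thick Kerr collar chart with
windowed label and bounded boost, smooth on the collar layer and `δ`-quiet in `C²` on its slab (`δ ≤ δ₁`),
has `¾ M₁⁻⁴ ≤ 192 M⁻⁴ + A δ` — by mass tracking at the equatorial image point. [cite: arXiv07060622, §3] -/
theorem Kerr.inv_mass_pow_four_le_of_quietCollar [Kerr.Facts]
    (hQ : Kerr.kretschmannScalar_closedForm)
    {M a r₀ : ℝ} (hM : 0 < M) (hr₀ : M ≤ r₀) {m₀ : ℝ} (hm₀ : 0 < m₀) (ρ₀ : ℝ) :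
    ∃ δ₁ A : ℝ, 0 < δ₁ ∧ 0 ≤ A ∧ ∀ (M₁ a₁ : ℝ) (Λ : lorentzGroup) (c : E4) (B : ModelBackground)
      (Φ₁ : B.domain → (Kerr.spacetime M a r₀ hM.le).carrier) (δ : ℝ),
      m₀ ≤ M₁ → M₁ ≤ m₀⁻¹ → |a₁| ≤ M₁ →
      ‖((Λ : E4 ≃L[ℝ] E4) : E4 →L[ℝ] E4)‖ ≤ ρ₀ → ‖((Λ : E4 ≃L[ℝ] E4).symm : E4 →L[ℝ] E4)‖ ≤ ρ₀ →
      B = starBackground Λ c M₁ a₁ (fun x ↦ Kerr.radius a₁ (poincareInv Λ c x)) →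
      ContMDiffOn 𝓘(ℝ, E4) (𝓡 4) ∞ Φ₁
        {x | -1 < B.time x.1 ∧ B.time x.1 < 1 ∧ B.radius x.1 < 3 * M₁ + 1} →
      0 ≤ δ → δ ≤ δ₁ →
      (Kerr.spacetime M a r₀ hM.le).truncDeviationCk B Φ₁ 2 (3 * M₁) 0 ≤ ENNReal.ofReal δ →
      3 / 4 * (M₁ ^ 4)⁻¹ ≤ 192 * (M ^ 4)⁻¹ + A * δ := by
  obtain ⟨δ₁, A, hδ₁, hA0, H⟩ := KerrWindow.abs_kretschmannAt_sub_le_of_truncDeviationCk_le hQ hm₀ ρ₀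
  refine ⟨δ₁, A, hδ₁, hA0, fun M₁ a₁ Λ c B Φ₁ δ hlo hhi ha₁ hΛ hΛ' hB hΦ hδ0 hδle hle ↦ ?_⟩
  have hM₁ : 0 < M₁ := hm₀.trans_le hlo
  -- the equatorial point is a point of the domain
  have hdomF : (B.domain : Set E4) = poincareInv Λ c ⁻¹' (Kerr.region a₁ M₁ : Set E4) := by rw [hB]; rfl
  set xe : E4 := (Λ : E4 ≃L[ℝ] E4) (KerrWindow.eqPoint M₁ a₁) + c with hxe
  have hP : poincareInv Λ c xe = KerrWindow.eqPoint M₁ a₁ := by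
    show (Λ : E4 ≃L[ℝ] E4).symm (xe - c) = KerrWindow.eqPoint M₁ a₁
    rw [hxe, add_sub_cancel_right, ContinuousLinearEquiv.symm_apply_apply]
  have hxe_dom : xe ∈ (B.domain : Set E4) := by
    rw [hdomF]; show poincareInv Λ c xe ∈ (Kerr.region a₁ M₁ : Set E4); rw [hP]
    exact KerrWindow.eqPoint_mem_region hm₀ (KerrWindow.mem_paramSet_of Λ hlo hhi ha₁ hΛ hΛ')
  have htrack := H _ M₁ a₁ Λ c B Φ₁ δ hlo hhi ha₁ hΛ hΛ' hB hΦ hδ0 hδle hle ⟨xe, hxe_dom⟩ rfl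
  -- the host bound at the image point
  set p := Φ₁ ⟨xe, hxe_dom⟩ with hp
  have hK := Kerr.abs_kretschmannAt_spacetime_le hQ hM.le p
  have hx : max r₀ 0 < Kerr.radius a p.1 := Kerr.mem_region.1 p.2
  have hrM : M < Kerr.radius a p.1 := lt_of_le_of_lt (hr₀.trans (le_max_left _ _)) hx
  have hr6 : 192 * M ^ 2 / Kerr.radius a p.1 ^ 6 ≤ 192 * (M ^ 4)⁻¹ := by
    have hM6 : M ^ 6 ≤ Kerr.radius a p.1 ^ 6 := pow_le_pow_left₀ hM.le hrM.le 6
    have hr6pos : 0 < Kerr.radius a p.1 ^ 6 := pow_pos (hM.trans hrM) 6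
    rw [div_le_iff₀ hr6pos]
    calc 192 * M ^ 2 = 192 * (M ^ 4)⁻¹ * M ^ 6 := by field_simp
      _ ≤ 192 * (M ^ 4)⁻¹ * Kerr.radius a p.1 ^ 6 := mul_le_mul_of_nonneg_left hM6 (by positivity)
  have hM4 : 48 * M₁ ^ 2 / (2 * M₁) ^ 6 = 3 / 4 * (M₁ ^ 4)⁻¹ := by
    field_simp; ring
  have h1 := (abs_sub_le_iff.1 htrack).2
  have h2 := (abs_le.1 hK).2
  rw [hM4] at h1
  linarith


end Literature.Geometry.Lorentzian

end
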